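import Literature.MathematicalPhysics.QuantumFieldTheory.King1986.TorusBlockForm

/-!
# King 1986, (4.5) AS AN OPERATOR IDENTITY on the finite torus: the block-RG effective Laplacian
# `Δ^{(k)} = a_k − a_k² Q_k G_k Q_k^*` has the plane-wave symbol `(a_k⁻¹ + Σ_l |u_k^η(p′+l)|² Δ^η(p′+l)⁻¹)⁻¹`,
# hence King's (4.33) holds for the operators themselves

C. King, *The U(1) Higgs model. I. The continuum limit*, Commun. Math. Phys. **102** (1986) 649–677
[bib `King1986`]: (2.13)–(2.14) p.653 define, for the block-spin transformation with block mean `Q_k` over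
`L^k`-blocks and Gaussian weight `exp(−(a_k/2)Σ|φ − Q_kψ|²)`, the propagator `G_k = (−Δ^η + m² + a_kQ_k^*Q_k)⁻¹`
and the unit-lattice EFFECTIVE LAPLACIAN `Δ^{(k)} = a_kI − a_k²Q_kG_kQ_k^*` (here with background field `A = 0`,
as in all of King's §4: «with free boundary conditions (and A = 0, of course)», p.670); (4.3)–(4.5) p.670 state
its plane-wave representation `Δ^{(k)}(p′) = (a_k⁻¹ + Σ_l |u_k^η(p′+l)|² Δ^η(p′+l)⁻¹)⁻¹` with the alias weights
`u_k^η` (4.3) and `Δ^η(p) = 4η⁻²Σ_μ sin²(½ηp_μ) + m²(L^kε)²` (4.4).  The companion modules vendor the symbol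
(`CompositionLaw.DeltaEff`, in the cell's `B4Strip` vocabulary `Ur`, `DeltaXir`, `shiftr`), its rate theory
(Lemmas 4.1–4.3, `EffectiveLaplacianRate`, `CompositionRate`), and King's (4.33)/(4.35)–(4.37) endpoint
coercivity `Δ^{(k)} + aL⁻²Q*Q ≥ γ₀` for translation-invariant operators WITH THAT SYMBOL (`EndpointCoercivity`,
`TorusBlockForm.endpoint_coercive_torus`, whose one remaining input was the symbol identification `hσ`).

THIS MODULE PROVES (4.5) ITSELF, as an identity between a concrete matrix and its quadratic form, on every
finite torus, and removes that last input.  Setting: unit torus `Ω = Π_μ ℤ/M_μ` (`Tor M`), fine torus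
`Ω_η = Π_μ ℤ/(NM_μ)` (`Tor (fine N M)`, `N = L^k = η⁻¹ ≥ 1`), block mean `Qmat : ℓ²(Ω_η) → ℓ²(Ω)` over the
`N`-blocks ((2.10), `(Qψ)(b) = N^{−d}Σ_{x∈B(b)}ψ(x)`), King's `η`-weighted `Q*Q = blockProj` (`TorusBlockForm`),
`A₀ = c(−Δ) + m² + aQ*Q` on `Ω_η` (`fineOp`; King's `Δ^η + m²` is `c = η⁻² = N²` in unit-lattice variables) and
`Δ_eff = a·1 − a²N^d·Q A₀⁻¹ Qᵀ` (`effLaplacian`; `N^dA₀⁻¹Qᵀ = G_kQ_k^*` in unweighted matrix conventions).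

MAIN RESULTS.
* `effLaplacian_form` (§6): for `a, c ≥ 0`, `m² > 0` and every real `φ` on `Ω`,
  `|Ω|·⟨φ, Δ_eff φ⟩ = Σ_{q∈Ω̂} a/(1 + aS(q)) |φ̃(q)|²`, `S(q) = Σ_{p ∈ fib q} |u(p)|²/σ(p)` — the plane-wave form
  (4.35) with an explicit symbol, `fib q` the alias fibre `{p ∈ Ω̂_η : p ≡ q}`, `u` the alias weight and `σ` the
  symbol of `c(−Δ)+m²` (`effSym_eq_inv`: `= (a⁻¹ + S(q))⁻¹` for `a > 0`).
* `effSym_eq_DeltaEff`, `effLaplacian_form_DeltaEff` (§7): for `c = N²` the symbol IS King's (4.5),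
  `a/(1 + aS(q)) = DeltaEff a N m² p′(q)`: the fibre is `{p′ + 2πm : m ∈ {0,…,N−1}^d}` (`sum_fib_eq_sum_pOf`, via
  the b05 lineage's `B5Block118.pOf`), `σ(p′+l) = Δ^η(p′+l)+m²` (`lapSym_pOf`) and `|u(p′+l)|² = Ur N m p′`
  (`norm_sq_u_pOf`, including the filled removable singularity at `p′ = 0 = l`).
* `energy_eq`, `effLaplacian_le_energy`, `effLaplacian_eq_energy` (§8): `Δ_eff` is King's DEFINITION —
  `⟨φ,Δ_eff φ⟩ = min_ψ [a‖φ − Qψ‖² + η^d⟨ψ,(c(−Δ)+m²)ψ⟩]`, attained at `ψ_φ = aN^dA₀⁻¹Qᵀφ` (the minimizer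
  `ℋ_kφ`), by completing the square (the quadratic part of the Gaussian integral (2.4)–(2.6)/(2.13)–(2.14)).
* `king433`, `king433_one` (§9): **King's (4.33) with NO hypothesis left** — on every torus `Π ℤ/(LM_μ)`, for the
  actual operators `Δ^{(k)} = effLaplacian N₁ … (N₁²) m₁²` and `Δ^{(k+n)}`, `a₁, a₀ ≥ a_min > 0`, `m² > 0`:
  `Δ^{(k)} + aL⁻²Q*Q` and `Δ^{(k+n)} + aL⁻²Q*Q` are `Coercive` with the same explicit `γ₀^F = gamma0F L a_min a d`
  (order `L⁻²`), uniformly in `k, n`, the masses and the torus — hypothesis (a) of `King1986.lemma45`.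

ARCHITECTURE (the printed route: Bloch/fibre decomposition of periodic block-spin operators, Bałaban–Feldman–
Knörrer–Trubowitz, *Bloch theory for periodic block spin transformations*, arXiv:1609.00964 [bib `BFKT2016Bloch`],
Lemma 6 (momentum kernels of products/inverses), Lemma 9 («(Q^*Qφ)^(p) = conj q̂(p) Σ_{π̂(p′)=π̂(p)} q̂(p′)φ̂(p′)»),
followed by a rank-one (Sherman–Morrison) inversion on each alias fibre — the computation behind (4.5) in [Ba 4] /
Gawędzki–Kupiainen).  §1 momentum-kernel calculus `hat` on any torus (`hat_one`, `hat_add`, `hat_smul`,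
`hat_mul`: `(ST)^ = |Ω|⁻¹ Ŝ·T̂`); §2 `lapF = c(−Δ)+m²`, translation invariance, symmetry, symbol `lapSym = m² +
cΣ(2 − 2cos p′_μ)` (`hat_lapF`, `symb_lapF`), coercivity `≥ m²`; §3 `Qmat`, `QᵀQ = N^{−d}·blockProj`, and
`(Qᵀφ)^(p) = conj u(p)·φ̃(red p)` (`ft_transpose_Qmat`, BFKT Lemma 9(a)); §4 `A₀ = fineOp`, invertible for
`m² > 0`, momentum kernel `Â₀ = |Ω_η|·B` with FIBRE BLOCKS `B(p,p″) = σ(p)δ + a[red p = red p″]u(p)conj u(p″)`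
(`hat_fineOp`); §5 the explicit fibre inverse `Cfib = δ/σ − κ(q)(u/σ)(conj u/σ)`, `κ = a/(1+aS)`, the LEFT-inverse
identity `Σ_{p′} C(p₀,p′)B(p′,p″) = δ` (`sum_Cfib_mul_Bfib`), hence `(A₀⁻¹)^ = |Ω_η|·[same fibre]·C` from
`A₀A₀⁻¹ = 1` and `hat_mul` (`hat_fineOp_inv` — no entry of a matrix inverse is ever computed), and
`Σ conj u(p)u(p′)C(p,p′) = S/(1+aS)` (`sum_conj_u_u_Cfib`); §6 assembly through `TorusBlockForm.transfer` and
Parseval; §7 the alias parametrisation and `2π`-periodicity; §8 completing the square; §9 =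
`EndpointCoercivity.endpoint_coercive_fibre` fed with `form_decomp_of_form` + §7 + `TorusBlockForm` §3–§5.

SCOPE / WHAT IS NOT HERE.  Background field `A = 0` and periodic boundary conditions (a torus) only — exactly
the setting of King's §4 computations; King transports the estimates to rectangular `Ω` with free boundary
conditions «by using multiple reflection representations … given explicitly in [Ba 4]» (p.670), which is not
formalised.  `m² > 0` is assumed throughout ((4.5) as printed has `Δ^η(0)⁻¹`, finite only for `m² > 0`; King's
Higgs field is massive).  The block profile is the flat mean (2.10) (King's covariant average `Q_k(A)` at
`A = 0`).  Nothing here concerns `A ≠ 0`, the vector-field operators, or [Ba 1–4] beyond the A = 0 formulas.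
Reused, not re-declared: `Tor`, `chi`, `sOf`, `fine` (`B5Prop11Plancherel`), `pOf`, `card_fine`, `iota`
(`B5Block118`), `ft`, `hat`, `transfer`, `symb`, `blockProj`, `red`, `fib`, `u`, `z`, `coef`, `norm_sq_u`,
`blockProj_fibre_form`, `pars_decomp`, `off_centre`, … (`TorusBlockForm`), `DeltaEff`, `composedInvResc`,
`uFactorr_eq_div` (`CompositionLaw`/`CompositionRate`), `qqSymbol`, `gamma0F`, `endpoint_coercive_fibre`
(`EndpointCoercivity`), `QGQInverse.Coercive`/`isUnit_of_coercive`.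

## References
* [King1986] C. King, Commun. Math. Phys. 102 (1986) 649–677 — (2.4)–(2.6) p.652, (2.10)–(2.15) pp.652–653,
  (4.1)–(4.5) p.670, (4.33), (4.35)–(4.37) p.674.
* [BFKT2016Bloch] T. Bałaban, J. Feldman, H. Knörrer, E. Trubowitz, *Bloch theory for periodic block spin
  transformations*, arXiv:1609.00964 (2016) — Lemma 6, Lemma 9, eq. (3).
* [Balaban1984PropagatorsI] T. Bałaban, Commun. Math. Phys. 95 (1984) 17–40 — (1.31) p.23 (the `p = p′ + l`
  parametrisation), for `pOf`.
* [Balaban1983RegularityDecay] T. Bałaban, Commun. Math. Phys. 89 (1983) 571–597 — (2.45) p.584 (`|u(p′+l)|²`).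
-/

noncomputable section

open Finset Real Matrix
open scoped BigOperators ComplexConjugate

namespace Literature.MathematicalPhysics.QuantumFieldTheory.King1986

open Literature.MathematicalPhysics.QuantumFieldTheory.Balaban1983to89
open Literature.MathematicalPhysics.QuantumFieldTheory.Balaban1983to89.B5Prop11Plancherel

namespace Torus

variable {d : ℕ}

/-! ## §1 Momentum-kernel calculus on a finite torus: `1̂`, linearity, products -/

section HatCalculus

variable (N : Fin d → ℕ) [hN : ∀ μ, NeZero (N μ)]

/-- `1̂(p,p′) = |Ω| δ_{p,p′}`. [cite: BFKT2016Bloch, Lemma 6(a)] -/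
theorem hat_one (p p' : Tor N) :
    hat N (1 : Matrix (Tor N) (Tor N) ℝ) p p'
      = if p - p' = 0 then (Fintype.card (Tor N) : ℂ) else 0 := by
  unfold hat
  rw [← sum_chi N (p - p')]
  refine Finset.sum_congr rfl fun y _ => ?_
  rw [Finset.sum_eq_single y]
  · rw [Matrix.one_apply_eq]; push_cast; rw [mul_one, chi_mul_conj_chi_left]
  · intro y' _ hy'
    rw [Matrix.one_apply_ne (Ne.symm hy')]; push_cast; rw [mul_zero, zero_mul]
  · intro h; exact absurd (Finset.mem_univ y) h

/-- `hat` is additive. [folklore] -/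
theorem hat_add (S T : Matrix (Tor N) (Tor N) ℝ) (p p' : Tor N) :
    hat N (S + T) p p' = hat N S p p' + hat N T p p' := by
  unfold hat
  rw [← Finset.sum_add_distrib]
  refine Finset.sum_congr rfl fun y _ => ?_
  rw [← Finset.sum_add_distrib]
  refine Finset.sum_congr rfl fun y' _ => ?_
  rw [Matrix.add_apply]; push_cast; ring

/-- `hat` is homogeneous. [folklore] -/
theorem hat_smul (c : ℝ) (T : Matrix (Tor N) (Tor N) ℝ) (p p' : Tor N) :
    hat N (c • T) p p' = (c : ℂ) * hat N T p p' := by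
  unfold hat
  rw [Finset.mul_sum]
  refine Finset.sum_congr rfl fun y _ => ?_
  rw [Finset.mul_sum]
  refine Finset.sum_congr rfl fun y' _ => ?_
  rw [Matrix.smul_apply, smul_eq_mul]; push_cast; ring

/-- **Products**: `(ST)^(p,p′) = |Ω|⁻¹ Σ_{p″} Ŝ(p,p″) T̂(p″,p′)`. [cite: BFKT2016Bloch, Lemma 6(b)] -/
theorem hat_mul (S T : Matrix (Tor N) (Tor N) ℝ) (p p' : Tor N) :
    hat N (S * T) p p'
      = ((Fintype.card (Tor N) : ℂ))⁻¹ * ∑ p'', hat N S p p'' * hat N T p'' p' := by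
  have hc : (Fintype.card (Tor N) : ℂ) ≠ 0 := by exact_mod_cast Fintype.card_ne_zero
  -- orthogonality inserted between the two kernels
  have hδ : ∀ z z' : Tor N, ∑ p'' : Tor N, conj (chi N p'' z) * chi N p'' z'
      = if z' - z = 0 then (Fintype.card (Tor N) : ℂ) else 0 := by
    intro z z'
    rw [← sum_chi_left N (z' - z)]
    exact Finset.sum_congr rfl fun p'' _ => conj_chi_mul_chi N p'' z z'
  symm
  calc ((Fintype.card (Tor N) : ℂ))⁻¹ * ∑ p'', hat N S p p'' * hat N T p'' p'
      = ((Fintype.card (Tor N) : ℂ))⁻¹ * ∑ y, ∑ z, ∑ z', ∑ y',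
          chi N p y * (S y z : ℂ) * (T z' y' : ℂ) * conj (chi N p' y')
            * ∑ p'', conj (chi N p'' z) * chi N p'' z' := by
        congr 1
        unfold hat
        -- expand the p''-sum of products of double sums
        calc ∑ p'', (∑ y, ∑ z, chi N p y * (S y z : ℂ) * conj (chi N p'' z))
              * (∑ z', ∑ y', chi N p'' z' * (T z' y' : ℂ) * conj (chi N p' y'))
            = ∑ p'', ∑ y, ∑ z, ∑ z', ∑ y',
                chi N p y * (S y z : ℂ) * (T z' y' : ℂ) * conj (chi N p' y')
                  * (conj (chi N p'' z) * chi N p'' z') := by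
              refine Finset.sum_congr rfl fun p'' _ => ?_
              rw [Finset.sum_mul_sum]
              refine Finset.sum_congr rfl fun y _ => ?_
              calc ∑ z', (∑ z, chi N p y * (S y z : ℂ) * conj (chi N p'' z))
                    * (∑ y', chi N p'' z' * (T z' y' : ℂ) * conj (chi N p' y'))
                  = ∑ z', ∑ z, ∑ y', (chi N p y * (S y z : ℂ) * conj (chi N p'' z))
                      * (chi N p'' z' * (T z' y' : ℂ) * conj (chi N p' y')) := by
                    refine Finset.sum_congr rfl fun z' _ => ?_
                    rw [Finset.sum_mul_sum]
                _ = ∑ z, ∑ z', ∑ y', (chi N p y * (S y z : ℂ) * conj (chi N p'' z))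
                      * (chi N p'' z' * (T z' y' : ℂ) * conj (chi N p' y')) := Finset.sum_comm
                _ = _ := by
                    refine Finset.sum_congr rfl fun z _ => Finset.sum_congr rfl fun z' _ =>
                      Finset.sum_congr rfl fun y' _ => ?_
                    ring
          _ = ∑ y, ∑ z, ∑ z', ∑ y', ∑ p'',
                chi N p y * (S y z : ℂ) * (T z' y' : ℂ) * conj (chi N p' y')
                  * (conj (chi N p'' z) * chi N p'' z') := by
              rw [Finset.sum_comm]
              refine Finset.sum_congr rfl fun y _ => ?_
              rw [Finset.sum_comm]
              refine Finset.sum_congr rfl fun z _ => ?_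
              rw [Finset.sum_comm]
              refine Finset.sum_congr rfl fun z' _ => ?_
              rw [Finset.sum_comm]
          _ = _ := by
              refine Finset.sum_congr rfl fun y _ => Finset.sum_congr rfl fun z _ =>
                Finset.sum_congr rfl fun z' _ => Finset.sum_congr rfl fun y' _ => ?_
              rw [Finset.mul_sum]
    _ = ∑ y, ∑ z, ∑ y', chi N p y * (S y z : ℂ) * (T z y' : ℂ) * conj (chi N p' y') := by
        rw [Finset.mul_sum]
        refine Finset.sum_congr rfl fun y _ => ?_
        rw [Finset.mul_sum]
        refine Finset.sum_congr rfl fun z _ => ?_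
        simp_rw [hδ]
        rw [Finset.mul_sum, Finset.sum_eq_single z]
        · rw [sub_self, if_pos rfl, Finset.mul_sum]
          refine Finset.sum_congr rfl fun y' _ => ?_
          field_simp
        · intro z' _ hz'
          rw [if_neg (sub_ne_zero.mpr hz')]
          simp
        · intro h; exact absurd (Finset.mem_univ z) h
    _ = hat N (S * T) p p' := by
        unfold hat
        refine Finset.sum_congr rfl fun y _ => ?_
        rw [Finset.sum_comm]
        refine Finset.sum_congr rfl fun y' _ => ?_
        rw [Matrix.mul_apply]
        push_cast
        rw [Finset.mul_sum, Finset.sum_mul]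
        exact Finset.sum_congr rfl fun z _ => by ring

end HatCalculus

/-! ## §2 The fine-lattice operator `−Δ^η + m²` on a torus `Π ℤ/K_μ` and its symbol -/

section Laplacian

variable (K : Fin d → ℕ) [hK : ∀ μ, NeZero (K μ)]

/-- The (scaled) nearest-neighbour operator `c·(−Δ) + m²` on the torus `Π_μ ℤ/K_μ`:
`(Dψ)(z) = (m² + 2dc)ψ(z) − c Σ_μ (ψ(z + e_μ) + ψ(z − e_μ))` (King's `Δ^η + m²(L^kε)²` with `c = η⁻²`,
(4.4); with periodic wrap-around when `K_μ ≤ 2`). [cite: King1986, (4.4) p.670] -/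
def lapF (c m2 : ℝ) : Matrix (Tor K) (Tor K) ℝ := fun z z' =>
  (m2 + 2 * d * c) * (if z' = z then 1 else 0)
    - c * ∑ μ : Fin d, ((if z' = z + unitVec K μ then 1 else 0) + (if z' = z - unitVec K μ then 1 else 0))

omit hK in
/-- `c·(−Δ) + m²` is translation invariant. [folklore] -/
theorem lapF_transl (c m2 : ℝ) (x y t : Tor K) : lapF K c m2 (x + t) (y + t) = lapF K c m2 x y := by
  unfold lapF
  have h1 : (y + t = x + t) ↔ (y = x) := add_left_inj t
  have h2 : ∀ μ, (y + t = x + t + unitVec K μ) ↔ (y = x + unitVec K μ) := fun μ => by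
    rw [add_right_comm, add_left_inj]
  have h3 : ∀ μ, (y + t = x + t - unitVec K μ) ↔ (y = x - unitVec K μ) := fun μ => by
    rw [add_sub_right_comm, add_left_inj]
  simp only [h1, h2, h3]


omit hK in
/-- `c·(−Δ) + m²` is symmetric. [folklore] -/
theorem lapF_comm (c m2 : ℝ) (z z' : Tor K) : lapF K c m2 z' z = lapF K c m2 z z' := by
  simp only [lapF]
  have h1 : (if z = z' then (1 : ℝ) else 0) = (if z' = z then 1 else 0) := if_congr eq_comm rfl rfl
  have h2 : ∀ μ : Fin d,
      ((if z = z' + unitVec K μ then (1 : ℝ) else 0) + (if z = z' - unitVec K μ then 1 else 0))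
        = ((if z' = z + unitVec K μ then (1 : ℝ) else 0) + (if z' = z - unitVec K μ then 1 else 0)) := by
    intro μ
    rw [add_comm]
    congr 1
    · exact if_congr ⟨fun h => by rw [h, sub_add_cancel], fun h => by rw [h, add_sub_cancel_right]⟩ rfl rfl
    · exact if_congr ⟨fun h => by rw [h, add_sub_cancel_right], fun h => by rw [h, sub_add_cancel]⟩ rfl rfl
  rw [h1]
  simp only [h2]
/-- The plane-wave SYMBOL of `c·(−Δ) + m²`: `m² + c Σ_μ (2 − 2cos p′_μ)` (`p′ = sOf`, the reduced momentum
of the torus `Π ℤ/K_μ`). [cite: King1986, (4.4) p.670] -/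
def lapSym (c m2 : ℝ) (p : Tor K) : ℝ := m2 + c * ∑ μ : Fin d, (2 - 2 * Real.cos (sOf K p μ))

/-- `e^{ip·e_μ} = e^{ip′_μ}` with the reduced momentum `p′_μ = 2π valMinAbs(p_μ)/K_μ`. [folklore] -/
theorem chi_unitVec_eq_exp (p : Tor K) (μ : Fin d) :
    chi K p (unitVec K μ) = Complex.exp ((sOf K p μ : ℝ) * Complex.I) := by
  rw [chi_unitVec]
  have h : p μ = (((p μ).valMinAbs : ℤ) : ZMod (K μ)) := (ZMod.coe_valMinAbs (p μ)).symm
  conv_lhs => rw [h]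
  rw [ZMod.stdAddChar_coe]
  congr 1
  unfold sOf
  push_cast
  ring

/-- `e^{ip·e_μ} + e^{−ip·e_μ} = 2cos p′_μ`. [folklore] -/
theorem chi_unitVec_add_chi_neg (p : Tor K) (μ : Fin d) :
    chi K p (unitVec K μ) + chi K p (-unitVec K μ) = ((2 * Real.cos (sOf K p μ) : ℝ) : ℂ) := by
  have hneg : chi K p (-unitVec K μ) = conj (chi K p (unitVec K μ)) := by
    rw [conj_chi, chi_neg_left]
  rw [hneg, Complex.add_conj, chi_unitVec_eq_exp, Complex.exp_ofReal_mul_I_re]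

/-- The kernel-row Fourier sum of `c·(−Δ) + m²` is its symbol: `Σ_z D(z,0) e^{ip·z} = m² + cΣ_μ(2 − 2cos p′_μ)`.
[cite: King1986, (4.4) p.670] -/
theorem kernel_sum_lapF (c m2 : ℝ) (p : Tor K) :
    ∑ z : Tor K, (lapF K c m2 z 0 : ℂ) * chi K p z = (lapSym K c m2 p : ℂ) := by
  have h0 : ∑ z : Tor K, (if (0 : Tor K) = z then chi K p z else 0) = 1 := by
    rw [Finset.sum_ite_eq]
    simp [B5Block118.chi_zero_right]
  have hplus : ∀ μ : Fin d, ∑ z : Tor K, (if (0 : Tor K) = z + unitVec K μ then chi K p z else 0)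
      = chi K p (-unitVec K μ) := by
    intro μ
    have : ∀ z : Tor K, ((0 : Tor K) = z + unitVec K μ) ↔ (-unitVec K μ = z) := fun z => by
      rw [eq_comm, add_eq_zero_iff_eq_neg, eq_comm]
    simp_rw [this]
    rw [Finset.sum_ite_eq]
    simp
  have hminus : ∀ μ : Fin d, ∑ z : Tor K, (if (0 : Tor K) = z - unitVec K μ then chi K p z else 0)
      = chi K p (unitVec K μ) := by
    intro μ
    have : ∀ z : Tor K, ((0 : Tor K) = z - unitVec K μ) ↔ (unitVec K μ = z) := fun z => by
      rw [eq_comm, sub_eq_zero, eq_comm]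
    simp_rw [this]
    rw [Finset.sum_ite_eq]
    simp
  have hexp : ∀ z : Tor K, (lapF K c m2 z 0 : ℂ) * chi K p z
      = ((m2 + 2 * d * c : ℝ) : ℂ) * (if (0 : Tor K) = z then chi K p z else 0)
        - (c : ℂ) * ∑ μ : Fin d, ((if (0 : Tor K) = z + unitVec K μ then chi K p z else 0)
            + (if (0 : Tor K) = z - unitVec K μ then chi K p z else 0)) := by
    intro z
    simp only [lapF]
    push_cast
    simp only [apply_ite Complex.ofReal, Complex.ofReal_one, Complex.ofReal_zero, sub_mul, mul_assoc,
      Finset.sum_mul, add_mul, ite_mul, one_mul, zero_mul]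
  simp_rw [hexp]
  rw [Finset.sum_sub_distrib, ← Finset.mul_sum, ← Finset.mul_sum, h0, Finset.sum_comm]
  have hcomm : ∀ μ : Fin d, chi K p (-unitVec K μ) + chi K p (unitVec K μ)
      = ((2 * Real.cos (sOf K p μ) : ℝ) : ℂ) := fun μ => by
    rw [add_comm, chi_unitVec_add_chi_neg]
  simp_rw [Finset.sum_add_distrib, hplus, hminus]
  rw [← Finset.sum_add_distrib]
  simp_rw [hcomm]
  unfold lapSym
  push_cast
  rw [Finset.sum_sub_distrib, Finset.sum_const, Finset.card_univ, Fintype.card_fin]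
  simp only [nsmul_eq_mul]
  ring

/-- The momentum kernel of `c·(−Δ) + m²`: diagonal with the symbol `lapSym`. [cite: King1986, (4.4)/(4.35)] -/
theorem hat_lapF (c m2 : ℝ) (p p' : Tor K) :
    hat K (lapF K c m2) p p' = (lapSym K c m2 p : ℂ) * (if p - p' = 0 then (Fintype.card (Tor K) : ℂ) else 0) := by
  rw [hat_of_transl K (lapF K c m2) (lapF_transl K c m2), kernel_sum_lapF]

omit hK in
/-- The symbol is at least `m²` (for `c ≥ 0`). [folklore] -/
theorem lapSym_ge (c m2 : ℝ) (hc : 0 ≤ c) (p : Tor K) : m2 ≤ lapSym K c m2 p := by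
  unfold lapSym
  have : 0 ≤ ∑ μ : Fin d, (2 - 2 * Real.cos (sOf K p μ)) :=
    Finset.sum_nonneg fun μ _ => by linarith [Real.cos_le_one (sOf K p μ)]
  nlinarith

/-- `symb (c·(−Δ) + m²) = lapSym`. [folklore] -/
theorem symb_lapF (c m2 : ℝ) (p : Tor K) : symb K (lapF K c m2) p = lapSym K c m2 p := by
  have h := kernel_sum_lapF K c m2 p
  have hre := congrArg Complex.re h
  rw [Complex.re_sum, Complex.ofReal_re] at hre
  rw [← hre]
  unfold symb
  exact Finset.sum_congr rfl fun z _ => (Complex.re_ofReal_mul _ _).symm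

/-- `⟨ψ, (c(−Δ) + m²)ψ⟩ ≥ m²⟨ψ, ψ⟩` on any torus (from (4.35) and the symbol bound). [folklore] -/
theorem lapF_coercive (c m2 : ℝ) (hc : 0 ≤ c) : QGQInverse.Coercive (lapF K c m2) m2 := by
  intro x
  have hcard : (0 : ℝ) < Fintype.card (Tor K) := by exact_mod_cast Fintype.card_pos
  have h := transl_form K (lapF K c m2) (lapF_transl K c m2) x
  have hle : m2 * ∑ p : Tor K, ‖ft K x p‖ ^ 2 ≤ ∑ p : Tor K, symb K (lapF K c m2) p * ‖ft K x p‖ ^ 2 := by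
    rw [Finset.mul_sum]
    exact Finset.sum_le_sum fun p _ =>
      mul_le_mul_of_nonneg_right (by rw [symb_lapF]; exact lapSym_ge K c m2 hc p) (sq_nonneg _)
  rw [← h, ← parseval_dot] at hle
  nlinarith

end Laplacian

/-! ## §3 Two levels: the block mean `Q : ℓ²(Ω_η) → ℓ²(Ω)`, `QᵀQ`, and the Fourier transform of `Qᵀφ` -/

section TwoLevel

variable (N : ℕ) [NeZero N] (M : Fin d → ℕ) [hM : ∀ μ, NeZero (M μ)]

/-- King's block MEAN `(Q_kψ)(y) = N^{−d} Σ_{x ∈ B(y)} ψ(x)` from the fine torus `Ω_η = Π ℤ/(N·M_μ)`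
(`N = L^k = η⁻¹`) to the unit torus `Ω = Π ℤ/M_μ`, as a real matrix. [cite: King1986, (2.4) p.652, (4.1)–(4.3) p.670] -/
def Qmat : Matrix (Tor M) (Tor (fine N M)) ℝ :=
  fun b z => if blockOf N M z = b then ((N : ℝ) ^ d)⁻¹ else 0

/-- `(Qᵀφ)(z) = N^{−d} φ(⌊z/N⌋)`. [folklore] -/
theorem transpose_Qmat_mulVec (φ : Tor M → ℝ) (z : Tor (fine N M)) :
    ((Qmat N M)ᵀ *ᵥ φ) z = ((N : ℝ) ^ d)⁻¹ * φ (blockOf N M z) := by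
  simp only [Matrix.mulVec, dotProduct, Matrix.transpose_apply, Qmat]
  simp_rw [ite_mul, zero_mul]
  rw [Finset.sum_ite_eq]
  simp

/-- `QᵀQ = N^{−d}·(Q*Q)`: with plain (unweighted) sums on both lattices the transpose of the block mean is
`N^{−d}` times King's `η`-weighted adjoint, so `QᵀQ = N^{−d}·blockProj`. [folklore] -/
theorem transpose_Qmat_mul_Qmat :
    (Qmat N M)ᵀ * Qmat N M = (((N : ℝ) ^ d)⁻¹) • blockProj N M := by
  ext z z'
  simp only [Matrix.mul_apply, Matrix.transpose_apply, Qmat, Matrix.smul_apply, blockProj, smul_eq_mul]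
  rw [Finset.sum_eq_single (blockOf N M z)]
  · rw [if_pos rfl]
    rcases eq_or_ne (blockOf N M z) (blockOf N M z') with h | h
    · rw [if_pos h.symm, if_pos h]
    · rw [if_neg (fun h' => h h'.symm), if_neg h]
  · intro b _ hb
    rw [if_neg (Ne.symm hb), zero_mul]
  · intro h; exact absurd (Finset.mem_univ _) h

/-- **The Fourier transform of `Qᵀφ` lives on the fibres**: `(Qᵀφ)^(p) = conj u(p) · φ̃(red p)`
(the fine-lattice transform of the block-constant extension is the alias weight times the unit-lattice
transform of `φ` at the reduced momentum). [cite: BFKT2016Bloch, Lemma 9(a) "(Q^*ψ)^(p) = conj q̂(p) ψ̂(π̂(p))"] -/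
theorem ft_transpose_Qmat (φ : Tor M → ℝ) (p : Tor (fine N M)) :
    ft (fine N M) ((Qmat N M)ᵀ *ᵥ φ) p = conj (u N M p) * ft M φ (red N M p) := by
  have hNd : ((N : ℂ) ^ d) ≠ 0 := pow_ne_zero _ (by exact_mod_cast NeZero.ne N)
  unfold ft
  simp_rw [transpose_Qmat_mulVec]
  push_cast
  calc ∑ z : Tor (fine N M), ((N : ℂ) ^ d)⁻¹ * (φ (blockOf N M z) : ℂ) * conj (chi (fine N M) p z)
      = ∑ bj : Tor M × (Fin d → Fin N),
          ((N : ℂ) ^ d)⁻¹ * (φ bj.1 : ℂ) * conj (chi (fine N M) p (site N M bj.1 bj.2)) := by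
        refine (Fintype.sum_equiv (blockEquiv N M) _ _ fun bj => ?_).symm
        rw [blockEquiv_apply, blockOf_site]
    _ = ∑ b : Tor M, ((N : ℂ) ^ d)⁻¹ * (φ b : ℂ)
          * conj (∑ j : Fin d → Fin N, chi (fine N M) p (site N M b j)) := by
        rw [Fintype.sum_prod_type]
        refine Finset.sum_congr rfl fun b _ => ?_
        rw [map_sum, Finset.mul_sum]
    _ = ∑ b : Tor M, conj (u N M p) * ((φ b : ℂ) * conj (chi M (red N M p) b)) := by
        refine Finset.sum_congr rfl fun b _ => ?_
        rw [sum_chi_site, chi_corner, map_mul, map_mul, map_pow, map_natCast]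
        field_simp
    _ = conj (u N M p) * ∑ b : Tor M, (φ b : ℂ) * conj (chi M (red N M p) b) := by
        rw [Finset.mul_sum]

/-! ## §4 The fine-lattice operator `A₀ = (c(−Δ) + m²) + a·Q*Q`: invertibility and momentum kernel -/

/-- `A₀ := c·(−Δ) + m² + a·(Q*Q)` on the fine torus (`c = η⁻² = N²` for King; `Q*Q = blockProj`).  King's
minimisation operator `η^d(−Δ^η + m²) + aQᵀQ` is `N^{−d}·A₀`. [cite: King1986, (4.1)–(4.5) p.670] -/
def fineOp (a c m2 : ℝ) : Matrix (Tor (fine N M)) (Tor (fine N M)) ℝ :=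
  lapF (fine N M) c m2 + a • blockProj N M

/-- `A₀ ≥ m²`. [folklore] -/
theorem fineOp_coercive {a c : ℝ} (m2 : ℝ) (ha : 0 ≤ a) (hc : 0 ≤ c) :
    QGQInverse.Coercive (fineOp N M a c m2) m2 := by
  intro x
  rw [fineOp, Matrix.add_mulVec, dotProduct_add, Matrix.smul_mulVec, dotProduct_smul, smul_eq_mul]
  have h1 := lapF_coercive (fine N M) c m2 hc x
  have h2 := blockProj_form_nonneg N M x
  nlinarith

/-- `A₀` is invertible when `m² > 0`. [folklore] -/
theorem fineOp_isUnit {a c m2 : ℝ} (ha : 0 ≤ a) (hc : 0 ≤ c) (hm : 0 < m2) : IsUnit (fineOp N M a c m2) :=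
  QGQInverse.isUnit_of_coercive hm (fineOp_coercive N M m2 ha hc)

/-- `A₀` is symmetric. [folklore] -/
theorem fineOp_transpose (a c m2 : ℝ) : (fineOp N M a c m2)ᵀ = fineOp N M a c m2 := by
  ext z z'
  rw [Matrix.transpose_apply, fineOp, Matrix.add_apply, Matrix.add_apply, Matrix.smul_apply,
    Matrix.smul_apply, lapF_comm]
  congr 1
  simp only [blockProj, smul_eq_mul]
  congr 1
  exact if_congr eq_comm rfl rfl

/-- The FIBRE BLOCKS of `Â₀ = |Ω_η|·B`: `B(p,p″) = σ(p)δ_{pp″} + a·[red p = red p″]·u(p) conj u(p″)` — diagonal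
Laplacian symbol plus a rank-one term on each alias fibre. [cite: BFKT2016Bloch, Lemma 9(b)] -/
def Bfib (a c m2 : ℝ) (p p'' : Tor (fine N M)) : ℂ :=
  (if p = p'' then (lapSym (fine N M) c m2 p : ℂ) else 0)
    + (if red N M p = red N M p'' then (a : ℂ) * (u N M p * conj (u N M p'')) else 0)

/-- `Â₀(p,p″) = |Ω_η|·B(p,p″)`. [folklore] -/
theorem hat_fineOp (a c m2 : ℝ) (p p'' : Tor (fine N M)) :
    hat (fine N M) (fineOp N M a c m2) p p'' = (Fintype.card (Tor (fine N M)) : ℂ) * Bfib N M a c m2 p p'' := by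
  rw [fineOp, hat_add, hat_smul, hat_lapF, hat_blockProj_eq]
  unfold Bfib
  simp only [sub_eq_zero]
  split_ifs <;> ring

/-! ## §5 The fibre inverse (Sherman–Morrison) and the momentum kernel of `A₀⁻¹` -/

/-- `S(q) = Σ_{p ∈ fib q} |u(p)|²/σ(p)` — King's alias sum `Σ_l |u(p′+l)|² Δ^η(p′+l)⁻¹` of (4.5), here over the
fibre of the reduction map. [cite: King1986, (4.5) p.670] -/
def Sfib (c m2 : ℝ) (q : Tor M) : ℝ :=
  ∑ p ∈ fib N M q, ‖u N M p‖ ^ 2 / lapSym (fine N M) c m2 p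

/-- The Sherman–Morrison coefficient `κ(q) = a/(1 + aS(q))`. [folklore] -/
def kap (a c m2 : ℝ) (q : Tor M) : ℝ := a / (1 + a * Sfib N M c m2 q)

/-- The candidate fibre inverse `C_q(p₀,p′) = δ_{p₀p′}/σ(p′) − κ(q)·(u(p₀)/σ(p₀))·(conj u(p′)/σ(p′))`
(Sherman–Morrison for `diag σ + a·u u^*`). [folklore] -/
def Cfib (a c m2 : ℝ) (q : Tor M) (p₀ p' : Tor (fine N M)) : ℂ :=
  (if p₀ = p' then ((lapSym (fine N M) c m2 p' : ℂ))⁻¹ else 0)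
    - (kap N M a c m2 q : ℂ) * (u N M p₀ / (lapSym (fine N M) c m2 p₀ : ℂ))
        * (conj (u N M p') / (lapSym (fine N M) c m2 p' : ℂ))

variable {N M}

/-- `S(q) ≥ 0`. [folklore] -/
theorem Sfib_nonneg {c m2 : ℝ} (hc : 0 ≤ c) (hm : 0 < m2) (q : Tor M) : 0 ≤ Sfib N M c m2 q :=
  Finset.sum_nonneg fun p _ => div_nonneg (sq_nonneg _)
    (le_trans hm.le (lapSym_ge (fine N M) c m2 hc p))

/-- `S(q)` as a complex sum `Σ conj u · u / σ`. [folklore] -/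
theorem Sfib_cast {c m2 : ℝ} (q : Tor M) :
    (Sfib N M c m2 q : ℂ) = ∑ p ∈ fib N M q, conj (u N M p) * u N M p / (lapSym (fine N M) c m2 p : ℂ) := by
  unfold Sfib
  push_cast
  refine Finset.sum_congr rfl fun p _ => ?_
  rw [Complex.conj_mul']

/-- `κ(1 + aS) = a`. [folklore] -/
theorem kap_mul {a c m2 : ℝ} (ha : 0 ≤ a) (hc : 0 ≤ c) (hm : 0 < m2) (q : Tor M) :
    kap N M a c m2 q * (1 + a * Sfib N M c m2 q) = a := by
  have hS := Sfib_nonneg (N := N) (M := M) hc hm q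
  unfold kap
  field_simp

/-- `1 − κS = 1/(1 + aS)`. [folklore] -/
theorem one_sub_kap_mul {a c m2 : ℝ} (ha : 0 ≤ a) (hc : 0 ≤ c) (hm : 0 < m2) (q : Tor M) :
    1 - kap N M a c m2 q * Sfib N M c m2 q = (1 + a * Sfib N M c m2 q)⁻¹ := by
  have hS := Sfib_nonneg (N := N) (M := M) hc hm q
  have hpos : (0 : ℝ) < 1 + a * Sfib N M c m2 q := by positivity
  unfold kap
  field_simp
  ring

/-- Column identity: for `p₀ ∈ fib q`, `Σ_{p ∈ fib q} C_q(p₀,p) u(p) = (u(p₀)/σ(p₀))·(1 − κS)`. [folklore] -/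
theorem sum_Cfib_mul_u {a c m2 : ℝ} (q : Tor M) {p₀ : Tor (fine N M)} (hp₀ : p₀ ∈ fib N M q) :
    ∑ p ∈ fib N M q, Cfib N M a c m2 q p₀ p * u N M p
      = (u N M p₀ / (lapSym (fine N M) c m2 p₀ : ℂ))
        * (1 - (kap N M a c m2 q : ℂ) * (Sfib N M c m2 q : ℂ)) := by
  unfold Cfib
  simp_rw [sub_mul, Finset.sum_sub_distrib, ite_mul, zero_mul]
  rw [Finset.sum_ite_eq, if_pos hp₀, Sfib_cast, Finset.mul_sum]
  have : ∀ p ∈ fib N M q, (kap N M a c m2 q : ℂ) * (u N M p₀ / (lapSym (fine N M) c m2 p₀ : ℂ))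
      * (conj (u N M p) / (lapSym (fine N M) c m2 p : ℂ)) * u N M p
      = u N M p₀ / (lapSym (fine N M) c m2 p₀ : ℂ)
        * ((kap N M a c m2 q : ℂ) * (conj (u N M p) * u N M p / (lapSym (fine N M) c m2 p : ℂ))) := by
    intro p _; ring
  rw [Finset.sum_congr rfl this, ← Finset.mul_sum]
  ring

/-- Row identity: for `p ∈ fib q`, `Σ_{p′ ∈ fib q} u(p′) C_q(p,p′) = (u(p)/σ(p))·(1 − κS)`. [folklore] -/
theorem sum_u_mul_Cfib {a c m2 : ℝ} (q : Tor M) {p : Tor (fine N M)} (hp : p ∈ fib N M q) :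
    ∑ p' ∈ fib N M q, u N M p' * Cfib N M a c m2 q p p'
      = (u N M p / (lapSym (fine N M) c m2 p : ℂ))
        * (1 - (kap N M a c m2 q : ℂ) * (Sfib N M c m2 q : ℂ)) := by
  unfold Cfib
  simp_rw [mul_sub, Finset.sum_sub_distrib, mul_ite, mul_zero]
  have h1 : ∑ p' ∈ fib N M q, (if p = p' then u N M p' * ((lapSym (fine N M) c m2 p' : ℂ))⁻¹ else 0)
      = u N M p / (lapSym (fine N M) c m2 p : ℂ) := by
    rw [Finset.sum_ite_eq, if_pos hp, div_eq_mul_inv]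
  rw [h1, Sfib_cast, Finset.mul_sum]
  have : ∀ p' ∈ fib N M q, u N M p' * ((kap N M a c m2 q : ℂ) * (u N M p / (lapSym (fine N M) c m2 p : ℂ))
      * (conj (u N M p') / (lapSym (fine N M) c m2 p' : ℂ)))
      = u N M p / (lapSym (fine N M) c m2 p : ℂ)
        * ((kap N M a c m2 q : ℂ) * (conj (u N M p') * u N M p' / (lapSym (fine N M) c m2 p' : ℂ))) := by
    intro p' _; ring
  rw [Finset.sum_congr rfl this, ← Finset.mul_sum]
  ring

/-- **`C_q` is a left inverse of the fibre block**: for `p₀ ∈ fib q` and every `p″`,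
`Σ_{p ∈ fib q} C_q(p₀,p) B(p,p″) = δ_{p₀p″}` (Sherman–Morrison). [folklore] -/
theorem sum_Cfib_mul_Bfib {a c m2 : ℝ} (ha : 0 ≤ a) (hc : 0 ≤ c) (hm : 0 < m2) (q : Tor M)
    {p₀ : Tor (fine N M)} (hp₀ : p₀ ∈ fib N M q) (p'' : Tor (fine N M)) :
    ∑ p ∈ fib N M q, Cfib N M a c m2 q p₀ p * Bfib N M a c m2 p p''
      = if p₀ = p'' then 1 else 0 := by
  have hq : red N M p₀ = q := (Finset.mem_filter.mp hp₀).2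
  have hσ : ∀ p : Tor (fine N M), (lapSym (fine N M) c m2 p : ℂ) ≠ 0 := fun p => by
    exact_mod_cast (lt_of_lt_of_le hm (lapSym_ge (fine N M) c m2 hc p)).ne'
  -- on the fibre, `red p = q`, so the rank-one indicator is `[q = red p'']`
  have hB : ∀ p ∈ fib N M q, Bfib N M a c m2 p p''
      = (if p = p'' then (lapSym (fine N M) c m2 p'' : ℂ) else 0)
        + (if q = red N M p'' then (a : ℂ) * conj (u N M p'') else 0) * u N M p := by
    intro p hp
    have hpq : red N M p = q := (Finset.mem_filter.mp hp).2
    unfold Bfib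
    rw [hpq]
    congr 1
    · split_ifs with h
      · rw [h]
      · rfl
    · split_ifs <;> ring
  rw [Finset.sum_congr rfl fun p hp => by rw [hB p hp, mul_add]]
  rw [Finset.sum_add_distrib]
  -- first sum: Σ_p C(p₀,p)·σ''δ_{p p''}
  have h1 : ∑ p ∈ fib N M q, Cfib N M a c m2 q p₀ p * (if p = p'' then (lapSym (fine N M) c m2 p'' : ℂ) else 0)
      = if p'' ∈ fib N M q then Cfib N M a c m2 q p₀ p'' * (lapSym (fine N M) c m2 p'' : ℂ) else 0 := by
    simp_rw [mul_ite, mul_zero]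
    rw [Finset.sum_ite_eq']
  have h2 : ∑ p ∈ fib N M q, Cfib N M a c m2 q p₀ p
        * ((if q = red N M p'' then (a : ℂ) * conj (u N M p'') else 0) * u N M p)
      = (if q = red N M p'' then (a : ℂ) * conj (u N M p'') else 0)
        * ∑ p ∈ fib N M q, Cfib N M a c m2 q p₀ p * u N M p := by
    rw [Finset.mul_sum]
    exact Finset.sum_congr rfl fun p _ => by ring
  rw [h1, h2, sum_Cfib_mul_u q hp₀]
  have hmem : p'' ∈ fib N M q ↔ q = red N M p'' := by
    rw [Finset.mem_filter]; simp [eq_comm]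
  have hkS : (1 : ℂ) - (kap N M a c m2 q : ℂ) * (Sfib N M c m2 q : ℂ)
      = ((1 + a * Sfib N M c m2 q : ℝ) : ℂ)⁻¹ := by
    have := one_sub_kap_mul (N := N) (M := M) ha hc hm q
    rw [← Complex.ofReal_inv, ← this]; push_cast; ring
  have hk : (kap N M a c m2 q : ℂ) * ((1 + a * Sfib N M c m2 q : ℝ) : ℂ) = a := by
    exact_mod_cast kap_mul (N := N) (M := M) ha hc hm q
  have hpos : ((1 + a * Sfib N M c m2 q : ℝ) : ℂ) ≠ 0 := by
    have hS := Sfib_nonneg (N := N) (M := M) hc hm q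
    exact_mod_cast (show (1 + a * Sfib N M c m2 q : ℝ) ≠ 0 by positivity)
  by_cases hfib : q = red N M p''
  · rw [if_pos (hmem.mpr hfib), if_pos hfib]
    unfold Cfib
    have hσ₀ := hσ p₀
    have hσ'' := hσ p''
    by_cases he : p₀ = p''
    · subst he
      rw [if_pos rfl, if_pos rfl, hkS]
      field_simp
      rw [← hk]
      ring
    · rw [if_neg he, if_neg he, hkS]
      field_simp
      rw [← hk]
      ring
  · rw [if_neg (fun h => hfib (hmem.mp h)), if_neg hfib]
    have hne : p₀ ≠ p'' := fun h => hfib (by rw [← hq, h])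
    rw [if_neg hne]
    ring

/-- The fibre bilinear form of `C_q` against the alias weights: `Σ_{p,p′ ∈ fib q} conj u(p) u(p′) C_q(p,p′) =
S(q)/(1 + aS(q))` — the value `⟨u, (σ + a uu^*)⁻¹ u⟩ = S/(1+aS)` behind (4.5). [cite: King1986, (4.5) p.670] -/
theorem sum_conj_u_u_Cfib {a c m2 : ℝ} (ha : 0 ≤ a) (hc : 0 ≤ c) (hm : 0 < m2) (q : Tor M) :
    ∑ p ∈ fib N M q, ∑ p' ∈ fib N M q, conj (u N M p) * u N M p' * Cfib N M a c m2 q p p'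
      = ((Sfib N M c m2 q / (1 + a * Sfib N M c m2 q) : ℝ) : ℂ) := by
  have h1 : ∀ p ∈ fib N M q, ∑ p' ∈ fib N M q, conj (u N M p) * u N M p' * Cfib N M a c m2 q p p'
      = conj (u N M p) * ((u N M p / (lapSym (fine N M) c m2 p : ℂ))
        * (1 - (kap N M a c m2 q : ℂ) * (Sfib N M c m2 q : ℂ))) := by
    intro p hp
    rw [← sum_u_mul_Cfib q hp, Finset.mul_sum]
    exact Finset.sum_congr rfl fun p' _ => by ring
  rw [Finset.sum_congr rfl h1]
  have h2 : ∀ p ∈ fib N M q, conj (u N M p) * ((u N M p / (lapSym (fine N M) c m2 p : ℂ))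
        * (1 - (kap N M a c m2 q : ℂ) * (Sfib N M c m2 q : ℂ)))
      = (1 - (kap N M a c m2 q : ℂ) * (Sfib N M c m2 q : ℂ))
        * (conj (u N M p) * u N M p / (lapSym (fine N M) c m2 p : ℂ)) := by
    intro p _; ring
  rw [Finset.sum_congr rfl h2, ← Finset.mul_sum, ← Sfib_cast]
  have := one_sub_kap_mul (N := N) (M := M) ha hc hm q
  have hS := Sfib_nonneg (N := N) (M := M) hc hm q
  have hpos : (1 + a * Sfib N M c m2 q : ℝ) ≠ 0 := by positivity
  rw [show (1 : ℂ) - (kap N M a c m2 q : ℂ) * (Sfib N M c m2 q : ℂ)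
      = ((1 - kap N M a c m2 q * Sfib N M c m2 q : ℝ) : ℂ) by push_cast; ring, this]
  push_cast
  field_simp

variable (N M)

/-- **THE MOMENTUM KERNEL OF `A₀⁻¹`**: `(A₀⁻¹)^(p₀,p′) = |Ω_η|·[red p′ = red p₀]·C_{red p₀}(p₀,p′)` — block
diagonal over the alias fibres with the Sherman–Morrison blocks (from `A₀A₀⁻¹ = 1`, `hat_mul` and the left-inverse
identity; no matrix inverse is computed entrywise). [cite: BFKT2016Bloch, Lemma 6(b); King1986, (4.5) p.670] -/
theorem hat_fineOp_inv {a c m2 : ℝ} (ha : 0 ≤ a) (hc : 0 ≤ c) (hm : 0 < m2) (p₀ p' : Tor (fine N M)) :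
    hat (fine N M) (fineOp N M a c m2)⁻¹ p₀ p'
      = (Fintype.card (Tor (fine N M)) : ℂ)
        * (if red N M p' = red N M p₀ then Cfib N M a c m2 (red N M p₀) p₀ p' else 0) := by
  have hcard : (Fintype.card (Tor (fine N M)) : ℂ) ≠ 0 := by exact_mod_cast Fintype.card_ne_zero
  have hunit : IsUnit (fineOp N M a c m2).det :=
    (Matrix.isUnit_iff_isUnit_det _).mp (fineOp_isUnit N M ha hc hm)
  have hAA : fineOp N M a c m2 * (fineOp N M a c m2)⁻¹ = 1 := Matrix.mul_nonsing_inv _ hunit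
  -- (**) : Σ_p'' B(p,p'') H(p'',p') = |Ω_η| δ_{pp'}
  have hstar : ∀ p : Tor (fine N M),
      ∑ p'', Bfib N M a c m2 p p'' * hat (fine N M) (fineOp N M a c m2)⁻¹ p'' p'
        = if p = p' then (Fintype.card (Tor (fine N M)) : ℂ) else 0 := by
    intro p
    have h := hat_mul (fine N M) (fineOp N M a c m2) (fineOp N M a c m2)⁻¹ p p'
    rw [hAA, hat_one] at h
    simp only [sub_eq_zero, hat_fineOp] at h
    rw [h, Finset.mul_sum]
    refine Finset.sum_congr rfl fun p'' _ => ?_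
    field_simp
  have hp₀ : p₀ ∈ fib N M (red N M p₀) := by simp
  -- multiply (**) by C(p₀,·) and sum over the fibre of p₀
  have hsum := congrArg
    (fun f : Tor (fine N M) → ℂ => ∑ p ∈ fib N M (red N M p₀), Cfib N M a c m2 (red N M p₀) p₀ p * f p)
    (funext hstar)
  -- left side: exchange sums and use the left-inverse identity
  have hL : ∑ p ∈ fib N M (red N M p₀), Cfib N M a c m2 (red N M p₀) p₀ p
        * ∑ p'', Bfib N M a c m2 p p'' * hat (fine N M) (fineOp N M a c m2)⁻¹ p'' p'
      = hat (fine N M) (fineOp N M a c m2)⁻¹ p₀ p' := by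
    simp_rw [Finset.mul_sum]
    rw [Finset.sum_comm]
    have : ∀ p'' : Tor (fine N M), ∑ p ∈ fib N M (red N M p₀),
        Cfib N M a c m2 (red N M p₀) p₀ p * (Bfib N M a c m2 p p'' * hat (fine N M) (fineOp N M a c m2)⁻¹ p'' p')
        = (if p₀ = p'' then 1 else 0) * hat (fine N M) (fineOp N M a c m2)⁻¹ p'' p' := by
      intro p''
      rw [← sum_Cfib_mul_Bfib ha hc hm (red N M p₀) hp₀ p'', Finset.sum_mul]
      exact Finset.sum_congr rfl fun p _ => by ring
    simp_rw [this, ite_mul, one_mul, zero_mul]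
    rw [Finset.sum_ite_eq]
    simp
  -- right side
  have hR : ∑ p ∈ fib N M (red N M p₀), Cfib N M a c m2 (red N M p₀) p₀ p
        * (if p = p' then (Fintype.card (Tor (fine N M)) : ℂ) else 0)
      = (Fintype.card (Tor (fine N M)) : ℂ)
        * (if red N M p' = red N M p₀ then Cfib N M a c m2 (red N M p₀) p₀ p' else 0) := by
    simp_rw [mul_ite, mul_zero]
    rw [Finset.sum_ite_eq']
    simp only [Finset.mem_filter, Finset.mem_univ, true_and]
    split_ifs <;> ring
  have hsum' : ∑ p ∈ fib N M (red N M p₀), Cfib N M a c m2 (red N M p₀) p₀ p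
        * ∑ p'', Bfib N M a c m2 p p'' * hat (fine N M) (fineOp N M a c m2)⁻¹ p'' p'
      = ∑ p ∈ fib N M (red N M p₀), Cfib N M a c m2 (red N M p₀) p₀ p
        * (if p = p' then (Fintype.card (Tor (fine N M)) : ℂ) else 0) := hsum
  rw [hL, hR] at hsum'
  exact hsum'

end TwoLevel

/-! ## §6 King's effective Laplacian `a − a² Q G Qᵀ` and its plane-wave form -/

section Effective

variable (N : ℕ) [NeZero N] (M : Fin d → ℕ) [hM : ∀ μ, NeZero (M μ)]

/-- **King's block-RG effective Laplacian on the unit torus, as a real matrix**: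
`Δ_eff = a·1 − a²·N^d·Q A₀⁻¹ Qᵀ = a − a² Q_k G_k Q_k^*`, `G_k = (η^d(c(−Δ^η)+m²) + aQᵀQ)⁻¹ = N^d A₀⁻¹` — the
quadratic form produced by the Gaussian block integral `exp(−½⟨φ,Δ^{(k)}φ⟩) ∝ ∫dψ exp(−½η^dΣψ(c(−Δ)+m²)ψ −
(a/2)‖φ − Qψ‖²)`, i.e. the minimum over `ψ` (see `effLaplacian_le_energy` / `effLaplacian_eq_energy`).
[cite: King1986, (2.4)–(2.6) p.652, (4.5) p.670] -/
def effLaplacian (a c m2 : ℝ) : Matrix (Tor M) (Tor M) ℝ :=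
  a • (1 : Matrix (Tor M) (Tor M) ℝ)
    - (a ^ 2 * (N : ℝ) ^ d) • (Qmat N M * (fineOp N M a c m2)⁻¹ * (Qmat N M)ᵀ)

/-- The plane-wave symbol `a/(1 + aS(q)) = (a⁻¹ + S(q))⁻¹` of the effective Laplacian.
[cite: King1986, (4.5) p.670] -/
def effSym (a c m2 : ℝ) (q : Tor M) : ℝ := a / (1 + a * Sfib N M c m2 q)

/-- **The sandwich `⟨Qᵀφ, A₀⁻¹Qᵀφ⟩` in momentum space**:
`|Ω_η|·⟨Qᵀφ, A₀⁻¹ Qᵀφ⟩ = Σ_q S(q)/(1 + aS(q)) |φ̃(q)|²`. [cite: King1986, (4.5) p.670; BFKT2016Bloch, Lemma 9] -/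
theorem inv_sandwich_form {a c m2 : ℝ} (ha : 0 ≤ a) (hc : 0 ≤ c) (hm : 0 < m2) (φ : Tor M → ℝ) :
    (Fintype.card (Tor (fine N M)) : ℝ)
        * (((Qmat N M)ᵀ *ᵥ φ) ⬝ᵥ ((fineOp N M a c m2)⁻¹ *ᵥ ((Qmat N M)ᵀ *ᵥ φ)))
      = ∑ q : Tor M, (Sfib N M c m2 q / (1 + a * Sfib N M c m2 q)) * ‖ft M φ q‖ ^ 2 := by
  have hc0 : (Fintype.card (Tor (fine N M)) : ℂ) ≠ 0 := by exact_mod_cast Fintype.card_ne_zero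
  have h := transfer (fine N M) (fineOp N M a c m2)⁻¹ ((Qmat N M)ᵀ *ᵥ φ)
  simp_rw [ft_transpose_Qmat, hat_fineOp_inv N M ha hc hm] at h
  -- the inner sum over p' lives on the fibre of p
  have hin : ∀ p : Tor (fine N M),
      ∑ p', conj (u N M p) * ft M φ (red N M p) * conj (conj (u N M p') * ft M φ (red N M p'))
          * ((Fintype.card (Tor (fine N M)) : ℂ)
            * (if red N M p' = red N M p then Cfib N M a c m2 (red N M p) p p' else 0))
        = (Fintype.card (Tor (fine N M)) : ℂ) * ((‖ft M φ (red N M p)‖ : ℂ) ^ 2)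
          * ∑ p' ∈ fib N M (red N M p), conj (u N M p) * u N M p' * Cfib N M a c m2 (red N M p) p p' := by
    intro p
    have h1 : ∀ p', conj (u N M p) * ft M φ (red N M p) * conj (conj (u N M p') * ft M φ (red N M p'))
          * ((Fintype.card (Tor (fine N M)) : ℂ)
            * (if red N M p' = red N M p then Cfib N M a c m2 (red N M p) p p' else 0))
        = if red N M p' = red N M p then
            (Fintype.card (Tor (fine N M)) : ℂ) * (ft M φ (red N M p) * conj (ft M φ (red N M p')))
              * (conj (u N M p) * u N M p' * Cfib N M a c m2 (red N M p) p p') else 0 := by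
      intro p'
      rw [map_mul, Complex.conj_conj]
      split_ifs <;> ring
    simp_rw [h1]
    rw [← Finset.sum_filter, Finset.mul_sum]
    refine Finset.sum_congr rfl fun p' hp' => ?_
    rw [(Finset.mem_filter.mp hp').2, Complex.mul_conj']
  simp_rw [hin] at h
  -- regroup the outer sum by fibres
  have hout : ∑ p : Tor (fine N M), (Fintype.card (Tor (fine N M)) : ℂ) * ((‖ft M φ (red N M p)‖ : ℂ) ^ 2)
        * ∑ p' ∈ fib N M (red N M p), conj (u N M p) * u N M p' * Cfib N M a c m2 (red N M p) p p'
      = (Fintype.card (Tor (fine N M)) : ℂ) * ∑ q : Tor M,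
          ((Sfib N M c m2 q / (1 + a * Sfib N M c m2 q) : ℝ) : ℂ) * ((‖ft M φ q‖ : ℂ) ^ 2) := by
    rw [← Finset.sum_fiberwise Finset.univ (red N M) (fun p =>
      (Fintype.card (Tor (fine N M)) : ℂ) * ((‖ft M φ (red N M p)‖ : ℂ) ^ 2)
        * ∑ p' ∈ fib N M (red N M p), conj (u N M p) * u N M p' * Cfib N M a c m2 (red N M p) p p'),
      Finset.mul_sum]
    refine Finset.sum_congr rfl fun q _ => ?_
    rw [Finset.sum_congr rfl fun p hp => by rw [(Finset.mem_filter.mp hp).2], ← Finset.mul_sum,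
      sum_conj_u_u_Cfib ha hc hm q]
    ring
  rw [hout] at h
  -- cancel one factor |Ω_η| and return to ℝ
  rw [pow_two, mul_assoc] at h
  have h3 := mul_left_cancel₀ hc0 h
  apply Complex.ofReal_injective
  push_cast
  rw [h3]
  refine Finset.sum_congr rfl fun q _ => ?_
  push_cast
  ring

/-- **KING'S (4.5) AS AN OPERATOR IDENTITY.**  For the block-RG effective Laplacian
`Δ_eff = a − a²N^d Q A₀⁻¹ Qᵀ` on the unit torus `Ω = Π ℤ/M_μ` (fine torus `Π ℤ/(NM_μ)`, block mean `Q` over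
`N`-blocks, `A₀ = c(−Δ) + m² + a·Q*Q`, any `a ≥ 0`, `c ≥ 0`, `m² > 0`):
`|Ω|·⟨φ, Δ_eff φ⟩ = Σ_q (a⁻¹ + S(q))⁻¹ |φ̃(q)|²`, `S(q) = Σ_{p ∈ fib q} |u(p)|²/σ(p)`,
i.e. `Δ_eff` has the plane-wave form (4.35) with the symbol (4.5). [cite: King1986, (4.5) p.670, (4.35) p.674] -/
theorem effLaplacian_form {a c m2 : ℝ} (ha : 0 ≤ a) (hc : 0 ≤ c) (hm : 0 < m2) (φ : Tor M → ℝ) :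
    (Fintype.card (Tor M) : ℝ) * (φ ⬝ᵥ (effLaplacian N M a c m2 *ᵥ φ))
      = ∑ q : Tor M, effSym N M a c m2 q * ‖ft M φ q‖ ^ 2 := by
  have hcM : (Fintype.card (Tor M) : ℝ) ≠ 0 := by exact_mod_cast Fintype.card_ne_zero
  have hNd : (0 : ℝ) < (N : ℝ) ^ d := by
    have : (0 : ℝ) < N := by exact_mod_cast Nat.pos_of_ne_zero (NeZero.ne N)
    positivity
  have hsand : φ ⬝ᵥ ((Qmat N M * (fineOp N M a c m2)⁻¹ * (Qmat N M)ᵀ) *ᵥ φ)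
      = ((Qmat N M)ᵀ *ᵥ φ) ⬝ᵥ ((fineOp N M a c m2)⁻¹ *ᵥ ((Qmat N M)ᵀ *ᵥ φ)) := by
    rw [← Matrix.mulVec_mulVec, ← Matrix.mulVec_mulVec, Matrix.dotProduct_mulVec,
      ← Matrix.mulVec_transpose]
  have hexp : φ ⬝ᵥ (effLaplacian N M a c m2 *ᵥ φ)
      = a * (φ ⬝ᵥ φ) - (a ^ 2 * (N : ℝ) ^ d)
        * (((Qmat N M)ᵀ *ᵥ φ) ⬝ᵥ ((fineOp N M a c m2)⁻¹ *ᵥ ((Qmat N M)ᵀ *ᵥ φ))) := by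
    rw [effLaplacian, Matrix.sub_mulVec, dotProduct_sub, Matrix.smul_mulVec, dotProduct_smul,
      Matrix.one_mulVec, Matrix.smul_mulVec, dotProduct_smul, hsand, smul_eq_mul, smul_eq_mul]
  rw [hexp, mul_sub, ← mul_assoc, mul_comm (Fintype.card (Tor M) : ℝ) a, mul_assoc, parseval_dot]
  have hS := inv_sandwich_form N M ha hc hm φ
  rw [B5Block118.card_fine N M] at hS
  -- |Ω| (a²N^d) X = a² (N^d |Ω| X)
  have hX : (Fintype.card (Tor M) : ℝ) * ((a ^ 2 * (N : ℝ) ^ d)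
        * (((Qmat N M)ᵀ *ᵥ φ) ⬝ᵥ ((fineOp N M a c m2)⁻¹ *ᵥ ((Qmat N M)ᵀ *ᵥ φ))))
      = a ^ 2 * ∑ q : Tor M, (Sfib N M c m2 q / (1 + a * Sfib N M c m2 q)) * ‖ft M φ q‖ ^ 2 := by
    rw [← hS]; ring
  rw [hX, Finset.mul_sum, Finset.mul_sum, ← Finset.sum_sub_distrib]
  refine Finset.sum_congr rfl fun q _ => ?_
  have hSq := Sfib_nonneg (N := N) (M := M) hc hm q
  have hpos : (1 + a * Sfib N M c m2 q) ≠ 0 := by positivity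
  unfold effSym
  field_simp
  ring

/-- With `a > 0` the symbol is `(a⁻¹ + S(q))⁻¹`, King's form of (4.5). [cite: King1986, (4.5) p.670] -/
theorem effSym_eq_inv {a c m2 : ℝ} (ha : 0 < a) (hc : 0 ≤ c) (hm : 0 < m2) (q : Tor M) :
    effSym N M a c m2 q = (a⁻¹ + Sfib N M c m2 q)⁻¹ := by
  have hSq := Sfib_nonneg (N := N) (M := M) hc hm q
  unfold effSym
  field_simp

end Effective

/-! ## §7 The symbol IS King's (4.5): `a/(1 + aS(q)) = Δ^{(k)}(p′) = DeltaEff a N m² p′` for `c = N²` -/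

section KingSymbol

variable (N : ℕ) [NeZero N] (M : Fin d → ℕ) [hM : ∀ μ, NeZero (M μ)]

omit [NeZero N] hM in
/-- The alias `p = p′ + l` (`l = 2πm`, index `v(q) + M·m mod NM`) reduces to `p′`: `red (pOf (m,q)) = q`.
[cite: Balaban1984PropagatorsI, (1.31) p.23] -/
theorem red_pOf (m : Fin d → Fin N) (q : Tor M) : red N M (B5Block118.pOf N M (m, q)) = q := by
  funext μ
  simp only [red, B5Block118.pOf]
  rw [map_intCast, Int.cast_add, ZMod.coe_valMinAbs, Int.cast_mul, Int.cast_natCast, ZMod.natCast_self,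
    zero_mul, add_zero]

/-- **The alias fibre is `{p′ + l : l ∈ 2π{0,…,N−1}^d}`**: `Σ_{p ∈ fib q} f(p) = Σ_m f(pOf (m,q))`.
[cite: Balaban1984PropagatorsI, (1.31) p.23; BFKT2016Bloch, §2 (the fibres `π̂⁻¹(𝔮)`)] -/
theorem sum_fib_eq_sum_pOf {β : Type*} [AddCommMonoid β] (q : Tor M) (f : Tor (fine N M) → β) :
    ∑ p ∈ fib N M q, f p = ∑ m : Fin d → Fin N, f (B5Block118.pOf N M (m, q)) := by
  symm
  refine Finset.sum_nbij (fun m => B5Block118.pOf N M (m, q)) ?_ ?_ ?_ ?_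
  · intro m _
    exact Finset.mem_filter.mpr ⟨Finset.mem_univ _, red_pOf N M m q⟩
  · intro m₁ _ m₂ _ h
    exact (Prod.ext_iff.mp (B5Block118.pOf_injective N M h)).1
  · intro p hp
    obtain ⟨⟨m, q'⟩, h⟩ := (B5Block118.pOf_bijective N M).2 p
    have hq' : q' = q := by
      rw [← red_pOf N M m q', h]
      exact (Finset.mem_filter.mp (Finset.mem_coe.mp hp)).2
    subst hq'
    exact ⟨m, Finset.mem_coe.mpr (Finset.mem_univ _), h⟩
  · intro m _
    rfl

/-- The fine reduced momentum of the alias `p′ + l` is `(p′_μ + 2πm_μ)/N` modulo `2π`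
(`2π·v_{NM}(v(q) + Mm)/(NM)` with `v_{NM}` the centred residue). [folklore] -/
theorem sOf_pOf (m : Fin d → Fin N) (q : Tor M) (μ : Fin d) :
    ∃ j : ℤ, sOf (fine N M) (B5Block118.pOf N M (m, q)) μ
      = (sOf M q μ + ((m μ : ℕ) : ℝ) * (2 * π)) / N + (j : ℝ) * (2 * π) := by
  have hN : (N : ℝ) ≠ 0 := by exact_mod_cast NeZero.ne N
  have hMμ : (M μ : ℝ) ≠ 0 := by exact_mod_cast NeZero.ne (M μ)
  have hcong : ((((B5Block118.pOf N M (m, q)) μ).valMinAbs : ℤ) : ZMod (fine N M μ))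
      = (((q μ).valMinAbs + (M μ : ℤ) * ((m μ : ℕ) : ℤ) : ℤ) : ZMod (fine N M μ)) := by
    rw [ZMod.coe_valMinAbs]; rfl
  rw [ZMod.intCast_eq_intCast_iff_dvd_sub] at hcong
  obtain ⟨j, hj⟩ := hcong
  have hfine : ((fine N M μ : ℕ) : ℤ) = (N : ℤ) * (M μ : ℤ) := by simp [fine]
  rw [hfine] at hj
  have hw : ((((B5Block118.pOf N M (m, q)) μ).valMinAbs : ℤ) : ℝ)
      = ((q μ).valMinAbs : ℝ) + (M μ : ℝ) * ((m μ : ℕ) : ℝ) - (N : ℝ) * (M μ : ℝ) * (j : ℝ) := by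
    have h := congrArg (fun z : ℤ => (z : ℝ)) hj
    push_cast at h
    linarith
  refine ⟨-j, ?_⟩
  have hθ : sOf (fine N M) (B5Block118.pOf N M (m, q)) μ
      = 2 * π * ((((B5Block118.pOf N M (m, q)) μ).valMinAbs : ℤ) : ℝ) / ((N : ℝ) * (M μ : ℝ)) := by
    simp only [sOf, fine, Nat.cast_mul]
  have hs : sOf M q μ = 2 * π * ((q μ).valMinAbs : ℝ) / (M μ : ℝ) := rfl
  rw [hθ, hw, hs]
  push_cast
  field_simp
  ring

/-- **The fine symbol at the alias is `Δ^η(p′+l) + m²`** (in the `B4Strip` scaling `c = N²`):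
`lapSym (fine N M) N² m² (pOf (m,q)) = DeltaXir N m² (p′ + 2πm)`. [cite: King1986, (4.4) p.670] -/
theorem lapSym_pOf (m2 : ℝ) (m : Fin d → Fin N) (q : Tor M) :
    lapSym (fine N M) ((N : ℝ) ^ 2) m2 (B5Block118.pOf N M (m, q))
      = B4Strip.DeltaXir N m2 (B4Strip.shiftr N m (sOf M q)) := by
  unfold lapSym B4Strip.DeltaXir
  rw [add_comm, Finset.mul_sum]
  congr 1
  refine Finset.sum_congr rfl fun μ _ => ?_
  obtain ⟨j, hj⟩ := sOf_pOf N M m q μ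
  simp only [B4Strip.Sxir, B4Strip.shiftr]
  rw [hj, Real.cos_add_int_mul_two_pi]
  have h : (sOf M q μ + ((m μ : ℕ) : ℝ) * (2 * π)) / N = (sOf M q μ + 2 * π * ((m μ : ℕ) : ℝ)) / N := by
    ring
  rw [h]

/-- **One coordinate of `|u(p′+l)|²`**: `uFactorr N 0 (Nθ_μ) = uFactorr N m_μ p′_μ` for the fine angle
`θ_μ` of the alias `p′ + l` (both the generic value `S₁(p′_μ)/S_ξ(p′_μ+2πm_μ)` and the filled removable
singularity `1` at `p′_μ = 0 = m_μ` match). [cite: King1986, (4.3) p.670; Balaban1983RegularityDecay, (2.45) p.584] -/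
theorem uFactorr_pOf (m : Fin d → Fin N) (q : Tor M) (μ : Fin d) :
    B4Strip.uFactorr N 0 ((N : ℝ) * sOf (fine N M) (B5Block118.pOf N M (m, q)) μ)
      = B4Strip.uFactorr N (m μ : ℕ) (sOf M q μ) := by
  have hN : (N : ℝ) ≠ 0 := by exact_mod_cast NeZero.ne N
  have hMμ : (M μ : ℝ) ≠ 0 := by exact_mod_cast NeZero.ne (M μ)
  obtain ⟨j, hj⟩ := sOf_pOf N M m q μ
  have hx : (N : ℝ) * sOf (fine N M) (B5Block118.pOf N M (m, q)) μ
      = sOf M q μ + ((m μ : ℕ) : ℝ) * (2 * π) + ((N * j : ℤ) : ℝ) * (2 * π) := by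
    rw [hj]
    push_cast
    field_simp
  by_cases h0 : B5Block118.pOf N M (m, q) μ = 0
  · -- the alias index vanishes: then `m_μ = 0` and `q_μ = 0` (injectivity of the parametrisation)
    have hinj : (Function.update m μ 0, Function.update q μ 0) = (m, q) := by
      apply B5Block118.pOf_injective N M
      funext ν
      by_cases hν : ν = μ
      · subst hν
        rw [h0]
        simp only [B5Block118.pOf, Function.update_self, ZMod.valMinAbs_zero, Fin.val_zero,
          Nat.cast_zero, mul_zero, add_zero, Int.cast_zero]
      · simp only [B5Block118.pOf, Function.update_of_ne hν]
    have hm0 : m μ = 0 := by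
      have h1 := congrFun (congrArg Prod.fst hinj) μ
      simp only [Function.update_self] at h1
      exact h1.symm
    have hq0 : q μ = 0 := by
      have h1 := congrFun (congrArg Prod.snd hinj) μ
      simp only [Function.update_self] at h1
      exact h1.symm
    have hθ0 : sOf (fine N M) (B5Block118.pOf N M (m, q)) μ = 0 := by
      simp only [sOf, h0, ZMod.valMinAbs_zero, Int.cast_zero, mul_zero, zero_div]
    have hs0 : sOf M q μ = 0 := by
      simp only [sOf, hq0, ZMod.valMinAbs_zero, Int.cast_zero, mul_zero, zero_div]
    rw [hθ0, mul_zero, hs0, hm0, Fin.val_zero]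
  · -- generic alias: both sides are `S₁/S_ξ` quotients, equal by `2π`-periodicity
    have hw : ((B5Block118.pOf N M (m, q) μ).valMinAbs : ℤ) ≠ 0 := by
      rwa [Ne, ZMod.valMinAbs_eq_zero]
    have hx0 : (N : ℝ) * sOf (fine N M) (B5Block118.pOf N M (m, q)) μ ≠ 0 := by
      have hw' : (((B5Block118.pOf N M (m, q) μ).valMinAbs : ℤ) : ℝ) ≠ 0 := by exact_mod_cast hw
      have hf : ((fine N M μ : ℕ) : ℝ) ≠ 0 := by exact_mod_cast NeZero.ne (fine N M μ)
      simp only [sOf]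
      exact mul_ne_zero hN
        (div_ne_zero (mul_ne_zero (mul_ne_zero two_ne_zero Real.pi_ne_zero) hw') hf)
    have hms : (m μ : ℕ) ≠ 0 ∨ sOf M q μ ≠ 0 := by
      by_cases hm0 : (m μ : ℕ) = 0
      · right
        intro hs0
        have hv : ((q μ).valMinAbs : ℝ) = 0 := by
          have h2 : sOf M q μ * (M μ : ℝ) / (2 * π) = ((q μ).valMinAbs : ℝ) := by
            simp only [sOf]
            field_simp
          rw [← h2, hs0, zero_mul, zero_div]
        have hv' : (q μ).valMinAbs = 0 := by exact_mod_cast hv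
        apply h0
        show (((q μ).valMinAbs + (M μ : ℤ) * ((m μ : ℕ) : ℤ) : ℤ) : ZMod (fine N M μ)) = 0
        rw [hv', hm0]
        push_cast
        ring
      · exact Or.inl hm0
    rw [uFactorr_eq_div (Or.inr hx0), uFactorr_eq_div hms]
    push_cast
    rw [mul_zero, add_zero]
    congr 1
    · simp only [B4Strip.S1r]
      rw [hx, Real.cos_add_int_mul_two_pi, Real.cos_add_nat_mul_two_pi]
    · simp only [B4Strip.Sxir]
      rw [mul_div_cancel_left₀ _ hN, hj, Real.cos_add_int_mul_two_pi]
      have h : (sOf M q μ + ((m μ : ℕ) : ℝ) * (2 * π)) / N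
          = (sOf M q μ + 2 * π * ((m μ : ℕ) : ℝ)) / N := by ring
      rw [h]

/-- **`|u|²` at the alias `p′ + l` is B4's alias weight `|u(p′+l)|² = Ur N m p′`** (`N ≥ 1`).
[cite: King1986, (4.3) p.670; Balaban1983RegularityDecay, (2.45)–(2.46) p.584] -/
theorem norm_sq_u_pOf (hN1 : 1 ≤ N) (m : Fin d → Fin N) (q : Tor M) :
    ‖u N M (B5Block118.pOf N M (m, q))‖ ^ 2 = B4Strip.Ur N m (sOf M q) := by
  rw [norm_sq_u N M hN1]
  unfold qqSymbol B4Strip.Ur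
  exact Finset.prod_congr rfl fun μ _ => uFactorr_pOf N M m q μ

/-- **The fibre sum is King's alias sum**: for `c = N²`,
`S(q) = Σ_{p∈fib q} |u(p)|²/σ(p) = Σ_l |u(p′+l)|² Δ^η(p′+l)⁻¹` (`= composedInvResc a⁻¹ N m² p′ − a⁻¹`).
[cite: King1986, (4.5) p.670] -/
theorem Sfib_eq_aliasSum (hN1 : 1 ≤ N) (m2 : ℝ) (q : Tor M) :
    Sfib N M ((N : ℝ) ^ 2) m2 q
      = ∑ m : Fin d → Fin N, B4Strip.Ur N m (sOf M q)
          * (B4Strip.DeltaXir N m2 (B4Strip.shiftr N m (sOf M q)))⁻¹ := by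
  unfold Sfib
  rw [sum_fib_eq_sum_pOf]
  refine Finset.sum_congr rfl fun m _ => ?_
  rw [norm_sq_u_pOf N M hN1, lapSym_pOf, div_eq_mul_inv]

/-- **KING (4.5), THE SYMBOL**: for `c = N²` (`A₀ = N²(−Δ^η)+m²` in unit-lattice variables, i.e. King's
`Δ^η + m²` in `η = N⁻¹` units) and `a > 0`, the plane-wave symbol of `Δ_eff = a − a²N^dQA₀⁻¹Qᵀ` at the
coarse momentum `q` is `Δ^{(k)}(p′) = (a⁻¹ + Σ_l |u(p′+l)|² Δ^η(p′+l)⁻¹)⁻¹ = DeltaEff a N m² p′`, `p′ = sOf q`.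
[cite: King1986, (4.3)–(4.5) p.670] -/
theorem effSym_eq_DeltaEff (hN1 : 1 ≤ N) {a m2 : ℝ} (ha : 0 < a) (hm : 0 < m2) (q : Tor M) :
    effSym N M a ((N : ℝ) ^ 2) m2 q = DeltaEff a N m2 (sOf M q) := by
  rw [effSym_eq_inv N M ha (by positivity) hm, DeltaEff, composedInvResc, Sfib_eq_aliasSum N M hN1]

/-- **KING'S (4.5) AS AN OPERATOR IDENTITY, in King's own vocabulary**: on every torus
`Ω = Π_μ ℤ/M_μ` with fine torus `Π_μ ℤ/(NM_μ)` (`N = L^k = η⁻¹ ≥ 1`), for `a > 0`, `m² > 0`,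
`|Ω|·⟨φ, (a − a²N^d Q (N²(−Δ)+m²+aQᵀQ)⁻¹ Qᵀ) φ⟩ = Σ_q Δ^{(k)}(p′(q)) |φ̃(q)|²` with `Δ^{(k)} = DeltaEff a N m²`
the symbol (4.5). [cite: King1986, (4.5) p.670, (4.35) p.674] -/
theorem effLaplacian_form_DeltaEff (hN1 : 1 ≤ N) {a m2 : ℝ} (ha : 0 < a) (hm : 0 < m2)
    (φ : Tor M → ℝ) :
    (Fintype.card (Tor M) : ℝ) * (φ ⬝ᵥ (effLaplacian N M a ((N : ℝ) ^ 2) m2 *ᵥ φ))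
      = ∑ q : Tor M, DeltaEff a N m2 (sOf M q) * ‖ft M φ q‖ ^ 2 := by
  rw [effLaplacian_form N M ha.le (by positivity) hm]
  exact Finset.sum_congr rfl fun q _ => by rw [effSym_eq_DeltaEff N M hN1 ha hm]

end KingSymbol

/-! ## §8 `Δ_eff` is King's DEFINITION: the minimum of the block-spin quadratic form (2.4)–(2.6)/(2.13)–(2.14) -/

section Minimisation

variable (N : ℕ) [NeZero N] (M : Fin d → ℕ) [hM : ∀ μ, NeZero (M μ)]

/-- The block-spin ENERGY of a fine configuration `ψ` given the block field `φ`: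
`E_φ(ψ) = a‖φ − Qψ‖²_Ω + η^d⟨ψ, (c(−Δ)+m²)ψ⟩_{Ω_η}` (`η^d = N^{−d}` the Riemann weight of the fine torus) —
the exponent of King's renormalization transformation `T_{a,L^k}` (2.4)/(2.10) applied to the Gaussian
`exp(−½η^dΣψ(c(−Δ)+m²)ψ)`. [cite: King1986, (2.4)–(2.6) p.652, (2.10)–(2.14) pp.652–653] -/
def energy (a c m2 : ℝ) (φ : Tor M → ℝ) (ψ : Tor (fine N M) → ℝ) : ℝ :=
  a * ((φ - Qmat N M *ᵥ ψ) ⬝ᵥ (φ - Qmat N M *ᵥ ψ))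
    + ((N : ℝ) ^ d)⁻¹ * (ψ ⬝ᵥ (lapF (fine N M) c m2 *ᵥ ψ))

/-- The MINIMISER `ψ_φ = aN^d A₀⁻¹Qᵀφ` of the block-spin energy (King's minimizer kernel `ℋ_k = a_kG_kQ_k^*`
applied to `φ`, in unweighted matrix conventions). [cite: King1986, (2.13)–(2.15) p.653] -/
def minimiser (a c m2 : ℝ) (φ : Tor M → ℝ) : Tor (fine N M) → ℝ :=
  (a * (N : ℝ) ^ d) • ((fineOp N M a c m2)⁻¹ *ᵥ ((Qmat N M)ᵀ *ᵥ φ))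

/-- `⟨φ, Δ_eff φ⟩ = a⟨φ,φ⟩ − a²N^d⟨Qᵀφ, A₀⁻¹Qᵀφ⟩`. [cite: King1986, (2.14) p.653] -/
theorem effLaplacian_dot (a c m2 : ℝ) (φ : Tor M → ℝ) :
    φ ⬝ᵥ (effLaplacian N M a c m2 *ᵥ φ)
      = a * (φ ⬝ᵥ φ) - (a ^ 2 * (N : ℝ) ^ d)
        * (((Qmat N M)ᵀ *ᵥ φ) ⬝ᵥ ((fineOp N M a c m2)⁻¹ *ᵥ ((Qmat N M)ᵀ *ᵥ φ))) := by
  have hsand : φ ⬝ᵥ ((Qmat N M * (fineOp N M a c m2)⁻¹ * (Qmat N M)ᵀ) *ᵥ φ)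
      = ((Qmat N M)ᵀ *ᵥ φ) ⬝ᵥ ((fineOp N M a c m2)⁻¹ *ᵥ ((Qmat N M)ᵀ *ᵥ φ)) := by
    rw [← Matrix.mulVec_mulVec, ← Matrix.mulVec_mulVec, Matrix.dotProduct_mulVec,
      ← Matrix.mulVec_transpose]
  rw [effLaplacian, Matrix.sub_mulVec, dotProduct_sub, Matrix.smul_mulVec, dotProduct_smul,
    Matrix.one_mulVec, Matrix.smul_mulVec, dotProduct_smul, hsand, smul_eq_mul, smul_eq_mul]

/-- **COMPLETING THE SQUARE**: `E_φ(ψ) = ⟨φ, Δ_eff φ⟩ + N^{−d}⟨ψ − ψ_φ, A₀(ψ − ψ_φ)⟩`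
(`A₀ = c(−Δ) + m² + aQ*Q` symmetric and invertible for `m² > 0`). [cite: King1986, (2.4)–(2.6) p.652, (2.13)–(2.14) p.653] -/
theorem energy_eq {a c m2 : ℝ} (ha : 0 ≤ a) (hc : 0 ≤ c) (hm : 0 < m2) (φ : Tor M → ℝ)
    (ψ : Tor (fine N M) → ℝ) :
    energy N M a c m2 φ ψ
      = φ ⬝ᵥ (effLaplacian N M a c m2 *ᵥ φ)
        + ((N : ℝ) ^ d)⁻¹ * ((ψ - minimiser N M a c m2 φ)
            ⬝ᵥ (fineOp N M a c m2 *ᵥ (ψ - minimiser N M a c m2 φ))) := by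
  have hNd : ((N : ℝ) ^ d) ≠ 0 := pow_ne_zero _ (by exact_mod_cast NeZero.ne N)
  have hdet : IsUnit (fineOp N M a c m2).det :=
    (Matrix.isUnit_iff_isUnit_det _).mp (fineOp_isUnit N M ha hc hm)
  -- `A₀ ψ_φ = aN^d Qᵀφ`
  have F1 : fineOp N M a c m2 *ᵥ minimiser N M a c m2 φ = (a * (N : ℝ) ^ d) • ((Qmat N M)ᵀ *ᵥ φ) := by
    rw [minimiser, Matrix.mulVec_smul, Matrix.mulVec_mulVec, Matrix.mul_nonsing_inv _ hdet,
      Matrix.one_mulVec]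
  -- symmetry of `A₀`
  have F2 : ∀ x y : Tor (fine N M) → ℝ,
      x ⬝ᵥ (fineOp N M a c m2 *ᵥ y) = y ⬝ᵥ (fineOp N M a c m2 *ᵥ x) := by
    intro x y
    rw [Matrix.dotProduct_mulVec, ← Matrix.mulVec_transpose, fineOp_transpose, dotProduct_comm]
  have F3 : φ ⬝ᵥ (Qmat N M *ᵥ ψ) = ((Qmat N M)ᵀ *ᵥ φ) ⬝ᵥ ψ := by
    rw [Matrix.dotProduct_mulVec, ← Matrix.mulVec_transpose]
  have F4 : (Qmat N M *ᵥ ψ) ⬝ᵥ (Qmat N M *ᵥ ψ) = ((N : ℝ) ^ d)⁻¹ * (ψ ⬝ᵥ (blockProj N M *ᵥ ψ)) := by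
    rw [Matrix.dotProduct_mulVec, ← Matrix.mulVec_transpose, Matrix.mulVec_mulVec,
      transpose_Qmat_mul_Qmat, Matrix.smul_mulVec, smul_dotProduct, smul_eq_mul, dotProduct_comm]
  have F5 : ψ ⬝ᵥ (fineOp N M a c m2 *ᵥ ψ)
      = ψ ⬝ᵥ (lapF (fine N M) c m2 *ᵥ ψ) + a * (ψ ⬝ᵥ (blockProj N M *ᵥ ψ)) := by
    rw [fineOp, Matrix.add_mulVec, dotProduct_add, Matrix.smul_mulVec, dotProduct_smul, smul_eq_mul]
  have hsq : (φ - Qmat N M *ᵥ ψ) ⬝ᵥ (φ - Qmat N M *ᵥ ψ)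
      = φ ⬝ᵥ φ - 2 * (((Qmat N M)ᵀ *ᵥ φ) ⬝ᵥ ψ) + ((N : ℝ) ^ d)⁻¹ * (ψ ⬝ᵥ (blockProj N M *ᵥ ψ)) := by
    rw [dotProduct_sub, sub_dotProduct, sub_dotProduct, F4, dotProduct_comm (Qmat N M *ᵥ ψ) φ, F3]
    ring
  have hsq2 : (ψ - minimiser N M a c m2 φ) ⬝ᵥ (fineOp N M a c m2 *ᵥ (ψ - minimiser N M a c m2 φ))
      = ψ ⬝ᵥ (fineOp N M a c m2 *ᵥ ψ) - 2 * (a * (N : ℝ) ^ d) * (((Qmat N M)ᵀ *ᵥ φ) ⬝ᵥ ψ)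
        + (a * (N : ℝ) ^ d) ^ 2
          * (((Qmat N M)ᵀ *ᵥ φ) ⬝ᵥ ((fineOp N M a c m2)⁻¹ *ᵥ ((Qmat N M)ᵀ *ᵥ φ))) := by
    rw [Matrix.mulVec_sub, dotProduct_sub, sub_dotProduct, sub_dotProduct,
      F2 (minimiser N M a c m2 φ) ψ, F1, dotProduct_smul, dotProduct_smul]
    simp only [minimiser, smul_dotProduct, smul_eq_mul]
    rw [dotProduct_comm ψ ((Qmat N M)ᵀ *ᵥ φ),
      dotProduct_comm ((fineOp N M a c m2)⁻¹ *ᵥ ((Qmat N M)ᵀ *ᵥ φ)) ((Qmat N M)ᵀ *ᵥ φ)]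
    ring
  rw [energy, hsq, effLaplacian_dot, hsq2, F5]
  field_simp
  ring

/-- **`Δ_eff` IS KING'S EFFECTIVE LAPLACIAN (variational form of the Gaussian block integral)**:
`⟨φ, Δ_eff φ⟩ ≤ a‖φ − Qψ‖² + η^d⟨ψ,(c(−Δ)+m²)ψ⟩` for every fine `ψ` … [cite: King1986, (2.4)–(2.6) p.652, (2.14) p.653] -/
theorem effLaplacian_le_energy {a c m2 : ℝ} (ha : 0 ≤ a) (hc : 0 ≤ c) (hm : 0 < m2) (φ : Tor M → ℝ)
    (ψ : Tor (fine N M) → ℝ) :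
    φ ⬝ᵥ (effLaplacian N M a c m2 *ᵥ φ) ≤ energy N M a c m2 φ ψ := by
  rw [energy_eq N M ha hc hm]
  have hNd : (0 : ℝ) < ((N : ℝ) ^ d)⁻¹ :=
    inv_pos.mpr (pow_pos (by exact_mod_cast Nat.pos_of_ne_zero (NeZero.ne N)) _)
  have h1 := fineOp_coercive N M m2 ha hc (ψ - minimiser N M a c m2 φ)
  have h2 : 0 ≤ (ψ - minimiser N M a c m2 φ) ⬝ᵥ (ψ - minimiser N M a c m2 φ) :=
    Finset.sum_nonneg fun i _ => mul_self_nonneg _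
  have h3 : 0 ≤ (ψ - minimiser N M a c m2 φ)
      ⬝ᵥ (fineOp N M a c m2 *ᵥ (ψ - minimiser N M a c m2 φ)) :=
    le_trans (mul_nonneg hm.le h2) h1
  have h4 := mul_nonneg hNd.le h3
  linarith

/-- … with EQUALITY at the minimiser `ψ_φ = aN^dA₀⁻¹Qᵀφ`: `⟨φ, Δ_eff φ⟩ = min_ψ E_φ(ψ) = E_φ(ψ_φ)`.
[cite: King1986, (2.4)–(2.6) p.652, (2.13)–(2.14) p.653] -/
theorem effLaplacian_eq_energy {a c m2 : ℝ} (ha : 0 ≤ a) (hc : 0 ≤ c) (hm : 0 < m2) (φ : Tor M → ℝ) :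
    φ ⬝ᵥ (effLaplacian N M a c m2 *ᵥ φ) = energy N M a c m2 φ (minimiser N M a c m2 φ) := by
  rw [energy_eq N M ha hc hm, sub_self, Matrix.mulVec_zero, dotProduct_zero, mul_zero, add_zero]

end Minimisation

/-! ## §9 King's (4.33) for the ACTUAL operators `Δ^{(k)} + aL⁻²Q*Q`: no hypothesis left -/

section King433

variable (L : ℕ) [NeZero L] (M : Fin d → ℕ) [hM : ∀ μ, NeZero (M μ)]

/-- `TorusBlockForm.form_decomp` with the plane-wave FORM identity `|Ω|⟨x,Tx⟩ = Σ_p τ(p′(p))|x̃(p)|²` as input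
(instead of translation invariance + a symbol identification): (4.35) + (4.36) regrouped over the alias fibres.
[cite: King1986, (4.35)–(4.36) p.674; BFKT2016Bloch, Lemma 9] -/
theorem form_decomp_of_form (T : Matrix (Tor (fine L M)) (Tor (fine L M)) ℝ) (τ : (Fin d → ℝ) → ℝ)
    (hT : ∀ x : Tor (fine L M) → ℝ, (Fintype.card (Tor (fine L M)) : ℝ) * (x ⬝ᵥ (T *ᵥ x))
      = ∑ p, τ (sOf (fine L M) p) * ‖ft (fine L M) x p‖ ^ 2)
    (α : ℝ) (x : Tor (fine L M) → ℝ) :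
    x ⬝ᵥ ((T + α • blockProj L M) *ᵥ x)
      = ∑ q : Tor M, (∑ p ∈ fib L M q, τ (sOf (fine L M) p) * ‖coef L M x p‖ ^ 2
          + α * ‖∑ p ∈ fib L M q, u L M p * coef L M x p‖ ^ 2) := by
  have hc : (Fintype.card (Tor (fine L M)) : ℝ) ≠ 0 := by exact_mod_cast Fintype.card_ne_zero
  have hcpos : (0 : ℝ) ≤ Fintype.card (Tor (fine L M)) := by positivity
  set r : ℝ := (Real.sqrt (Fintype.card (Tor (fine L M))))⁻¹ with hr
  have hr2 : r ^ 2 = ((Fintype.card (Tor (fine L M)) : ℝ))⁻¹ := by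
    rw [hr, inv_pow, Real.sq_sqrt hcpos]
  rw [Matrix.add_mulVec, dotProduct_add, Matrix.smul_mulVec, dotProduct_smul, smul_eq_mul,
    Finset.sum_add_distrib]
  congr 1
  · have h1 : x ⬝ᵥ (T *ᵥ x)
        = ((Fintype.card (Tor (fine L M)) : ℝ))⁻¹ * ∑ p, τ (sOf (fine L M) p) * ‖ft (fine L M) x p‖ ^ 2 := by
      rw [← hT x, ← mul_assoc, inv_mul_cancel₀ hc, one_mul]
    rw [h1, Finset.mul_sum,
      ← Finset.sum_fiberwise Finset.univ (red L M)
        (fun p => ((Fintype.card (Tor (fine L M)) : ℝ))⁻¹ * (τ (sOf (fine L M) p) * ‖ft (fine L M) x p‖ ^ 2))]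
    refine Finset.sum_congr rfl fun q _ => Finset.sum_congr rfl fun p _ => ?_
    rw [norm_sq_coef]
    ring
  · rw [← Finset.mul_sum]
    congr 1
    have h2 : x ⬝ᵥ (blockProj L M *ᵥ x)
        = ((Fintype.card (Tor (fine L M)) : ℝ))⁻¹
          * ∑ q : Tor M, ‖∑ p ∈ fib L M q, u L M p * ft (fine L M) x p‖ ^ 2 := by
      rw [← blockProj_fibre_form, ← mul_assoc, inv_mul_cancel₀ hc, one_mul]
    rw [h2, Finset.mul_sum]
    refine Finset.sum_congr rfl fun q _ => ?_
    have h3 : ∑ p ∈ fib L M q, u L M p * coef L M x p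
        = (r : ℂ) * ∑ p ∈ fib L M q, u L M p * ft (fine L M) x p := by
      rw [Finset.mul_sum]
      refine Finset.sum_congr rfl fun p _ => ?_
      unfold coef
      rw [← hr]
      ring
    rw [h3, norm_mul, mul_pow, Complex.norm_real, Real.norm_eq_abs, sq_abs, hr2]

/-- **KING (4.33), HYPOTHESIS-FREE.**  On every torus `Ω = Π_μ ℤ/(LM_μ)` (`L ≥ 1` the block size of Lemma 4.5),
for King's ACTUAL effective Laplacians `Δ^{(k)} = a₁ − a₁²N₁^dQ(N₁²(−Δ)+m₁²+a₁QᵀQ)⁻¹Qᵀ` (`N₁ = L^k`) and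
`Δ^{(k+n)}` (same with `a₀, N₀ = L^{k+n}, m₀²`), `a₁, a₀ ≥ a_min > 0`, `m₁², m₀² > 0`, and the `L`-block-mean
projector `Q*Q = blockProj`:  BOTH `Δ^{(k)} + aL⁻²Q*Q` and `Δ^{(k+n)} + aL⁻²Q*Q` are coercive with the SAME
explicit constant `γ₀^F = gamma0F L a_min a d` (of order `L⁻²`), uniformly in `k`, `n`, the masses and the torus
— hypothesis (a) of `King1986.lemma45` for the operators themselves: (4.5) (`effLaplacian_form_DeltaEff`),
(4.35)–(4.37) (`TorusBlockForm`) and the two-alias-family bound (`EndpointCoercivity.fibre437`) composed.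
[cite: King1986, (4.5) p.670, (4.33), (4.35)–(4.37) p.674] -/
theorem king433 (hL : 1 ≤ L) {amin a a₁ a₀ : ℝ} (hamin : 0 < amin) (ha : 0 < a) (ha₁ : amin ≤ a₁)
    (ha₀ : amin ≤ a₀) (N₁ N₀ : ℕ) [NeZero N₁] [NeZero N₀] {m₁ m₀ : ℝ} (hm₁ : 0 < m₁) (hm₀ : 0 < m₀) :
    QGQInverse.Coercive
        (effLaplacian N₁ (fine L M) a₁ ((N₁ : ℝ) ^ 2) m₁ + (a * ((L : ℝ) ^ 2)⁻¹) • blockProj L M)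
        (gamma0F L amin a d)
      ∧ QGQInverse.Coercive
        (effLaplacian N₀ (fine L M) a₀ ((N₀ : ℝ) ^ 2) m₀ + (a * ((L : ℝ) ^ 2)⁻¹) • blockProj L M)
        (gamma0F L amin a d) :=
  have hN₁ : 1 ≤ N₁ := Nat.one_le_iff_ne_zero.mpr (NeZero.ne N₁)
  have hN₀ : 1 ≤ N₀ := Nat.one_le_iff_ne_zero.mpr (NeZero.ne N₀)
  endpoint_coercive_fibre hL hamin ha ha₁ ha₀ hN₁ hN₀ hm₁.le hm₀.le _ _ (fib L M) (z L M) (z_mem_fib L M)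
    (fun p => sOf (fine L M) p) (fun _ p _ μ => abs_sOf_le (fine L M) p μ)
    (fun _ _ hp hne => off_centre L M hp hne) (u L M) (fun f => norm_sq_u_central L M hL f)
    (fun f => (sum_fib_norm_sq_u L M f).le) (fun p x => coef L M x p)
    (form_decomp_of_form L M _ (DeltaEff a₁ N₁ m₁)
      (effLaplacian_form_DeltaEff N₁ (fine L M) hN₁ (lt_of_lt_of_le hamin ha₁) hm₁) _)
    (form_decomp_of_form L M _ (DeltaEff a₀ N₀ m₀)
      (effLaplacian_form_DeltaEff N₀ (fine L M) hN₀ (lt_of_lt_of_le hamin ha₀) hm₀) _)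
    (pars_decomp L M)

/-- One-operator form: `Δ^{(k)} + aL⁻²Q*Q ≥ γ₀^F` for King's effective Laplacian at any level `N = L^k ≥ 1`,
any `a₁ ≥ a_min > 0`, `m² > 0`, on any torus. [cite: King1986, (4.33) p.674] -/
theorem king433_one (hL : 1 ≤ L) {amin a a₁ : ℝ} (hamin : 0 < amin) (ha : 0 < a) (ha₁ : amin ≤ a₁)
    (N : ℕ) [NeZero N] {m2 : ℝ} (hm : 0 < m2) :
    QGQInverse.Coercive
      (effLaplacian N (fine L M) a₁ ((N : ℝ) ^ 2) m2 + (a * ((L : ℝ) ^ 2)⁻¹) • blockProj L M)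
      (gamma0F L amin a d) :=
  (king433 L M hL hamin ha ha₁ ha₁ N N hm hm).1

end King433

end Torus

end Literature.MathematicalPhysics.QuantumFieldTheory.King1986

end
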